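import Mathlib.NumberTheory.LegendreSymbol.JacobiSymbol
import Literature.NumberTheory.Automorphic.BrandtGrossPoints
import Literature.NumberTheory.Automorphic.BrandtXi
import Literature.NumberTheory.EllipticCurves.HeegnerPoints
import Literature.NumberTheory.EllipticCurves.GlobalMinimalModel
import Literature.NumberTheory.EllipticCurves.Selmer
import Literature.NumberTheory.EllipticCurves.Tamagawa
import Literature.NumberTheory.DiophantineGeometry.Conductor
import HarnessLib.Audit.Tags
import HarnessLib

/-!
# AN-43 — mod-2 Waldspurger on the DEFINITE side: the Gross toric period of a prime-conductor curve read MOD 2 versus the 2-descent of its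
# imaginary quadratic twists; T1 genus vanishing; T1⁺ / T1⁺ᵃ / T1⁺ᵇ vanishing at the prime 2 (cell `bsd-f1-sign2`, lens -an; -an g25 MEMO-an v1.73 §28,
# crux workfile `Cruxes/RankOneAtTwoBigImageOddLocal/DefiniteMod2WaldspurgerAN43.lean` v5 = `MEMO-an-data/g25/Sketch_g25_v5.lean` e18ded699efe069d; REF1-AUDIT §232;
# REF2-PLACEMENT-v57-add1 + v58 §1–§4 + v58-add1 §A; typer -ty g20; v2 = v1 p739960 + the Calegari–Emerton Lemma 13 cite for R58a, docstring-only;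
# v3 = v2 p741054 + APPEND of -an g26 §29 (Sketch v7 df87c63c6dfa9716: 10 new Props, REF1-AUDIT §243 all SURVIVE, REF2 v58-add2 §G / add3 §J) — the 8 v5 bodies byte-identical)
# v4 = v3 + APPEND of -an g26 §29.9–§29.14 (crux workfile v8.1 12f50d8f35088a7f: 9 more Props; REF1 §252) — earlier bodies byte-identical)
# v5 = v4 p746447 + REF2 riders R58g ([KedlayaMedvedovsky2019, Thm 2] on OddApTwoOfPrimeConductor / AxisRecursionAtTwo) and R58i ([BarreraPacettiTornaria2021, Thm 3.3] on (H)) — docstring-only, bodies byte-identical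

STATEMENTS ONLY (`def … : Prop` over tree declarations — the AN-43 law and its ⟸ half tagged `@[conjecture]` (conjecture-grade, NEW-COMBINATION), the rest PLAIN; nothing
asserted, no `sorry`, no instance, no named fact; -an's kernel lemma `law → AN-43⁻` and REF1 §232's BC7 certificates live in the sibling `DefiniteMod2WaldspurgerAtTwoKernel.lean`).
BSD is not proved by this; 23715 is not closed by this.  Typer edits = this header, the namespace (`…F1Sign2.ANg25`, as the earlier AN ports `ANg22/23/24`; -an's crux-workfile
namespace is `…Cruxes.RankOneAtTwoBigImageOddLocal.DefiniteMod2Waldspurger`), the imports (the sketch's route-thesis import `Theses.ByReductionTypeAtTwo` replaced by the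
Literature modules that declare the vocabulary), riders marked «RIDER» appended to the sketch docstrings, and the two `True`-valued notes of the sketch
(`oddToricPeriod_convention_note`, `toricPeriodVanishingAtTwo_falsifier_note`) folded into the docstrings of `OddToricPeriod` / `ToricPeriodVanishingAtTwo` as text.
The eight `def` bodies are Sketch v5 VERBATIM (= REF1 Probe232b/232c byte-for-byte).

OBJECTS (tree, `Literature/NumberTheory/Automorphic/BrandtGrossPoints.lean`, `BrandtXi.lean`): a definite set-up `S : Brandt.XiSetup 1 N` (quaternion algebra `S.D` ramified at
`N, ∞`, maximal order `S.O`), the Hecke eigen-line `Brandt.eigenLattice N (Brandt.matrix S.O) (a_p(W))_{p ∤ N} = ℤ ∙ φ` of `W` in `ℤ[Cls S.O]`, Gross points of conductor `1`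
`Brandt.IsGrossPoint S.O ψ I` (`ψ : K →ₐ[ℚ] S.D` optimal into `O_L(I)`), the `Pic(𝓞_K)`-orbit and the toric period `Brandt.toricPeriod S.O ψ I φ = Σ_𝔞 φ([𝔞]·[(ψ, I)])`
[cite: Gross1987Heights, §3 and §11] [cite: Vatsal2004, Theorem 6.4 and (7-5)]; `Brandt.weight S.O c = #O_L(c)ˣ/2`; the Frobenius reflection `ρ = τ_c ∘ σ_N` of the T1 mechanism
is `Brandt.grossReflect` (`Literature/NumberTheory/Automorphic/BrandtGrossPointReflection.lean`, typer g20, p739374: `IsGrossPoint.comp_algEquiv`, `…mul_normPrimeIdeal`,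
`act_mul_normPrimeIdeal = S.wMinus`, `toricPeriod_mul_normPrimeIdeal(_of_eigen)`, `act_reflect`).  BSD-side objects: `W.quadraticTwist d`, `W'.selmerGroup 2`, `W'.tamagawaProduct`,
`W.analyticRank`, `W.HasSurjectiveModNGaloisRep 2`, `IsImaginaryQuadratic K`, `NumberField.discr K`, `jacobiSym d N` (Kronecker symbol at the odd prime `N`).

ROWS (REF1-AUDIT §232, -ref1 g21, 2026-08-29T19:03Z; `REF1-data/b232/` Probe232b 36c19db7c4144df8 rc 0 / Probe232c 636273547b6b659a rc 0, BC7 a–j sorry-free; **all 7 SURVIVE,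
0 KILLED**):
* `OddToricPeriod W N K` (the parity carrier, `∃`-packaged: SOME set-up, SOME eigen-line generator, SOME Gross point, weighted period `Σ_𝔞 (w·φ)` ODD) — choice-free modulo R232a
  (SIGN: kernel `toricPeriod_neg`; SET-UP: maximal orders locally conjugate; ORBIT: `ψ ↦ ψ ∘ conj` swaps the two orbits and multiplies by the `T_N`-sign of `φ`, which rests on
  `T_N φ = ±φ` — multiplicity one at prime level — NOT stated by `eigenLattice`, which binds `p ∤ N` only; parity is sign-blind either way); with no set-up it is `False`
  (kernel `not_oddToricPeriod_of_isEmpty`), so the VANISHING rows and the ⟹ half are not junk-provable and the ⟸ half ASSERTS existence (right polarity, D-0015 bar met).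
* `DefiniteEigenLineExists` (PLAIN; construction statement, print: Eichler / Jacquet–Langlands + strong multiplicity one [cite: Gross1987Heights, §1–§5]) — SURVIVES.
* **AN-43 `DefiniteMod2WaldspurgerLaw`** (`@[conjecture]`) — for prime `N`, `r_an(W) = 0`, `S₃` image at 2, `Δ < 0`, `K` imaginary quadratic of discriminant `d < −4` with `N` inert:
  toric period ODD ⟺ (`Sel₂(W^{(d)}) = 1` ∧ `∏c(W^{(d)})` odd).  SURVIVES with the substantive rider **R232c**: the census box never enters the regime `Ш(W)[2] ≠ 0`; Gross's formula
  carries `L(W,1)`, so -an's bookkeeping (R1) must read `2·v₂(M_w) = v₂(L^alg(W)) + v₂(Ш_an∏c(W^{(d)})) + κ`; REF1 entered the regime at **571a1** (`L/Ω = 4`) and found the law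
  TRUE there for a different reason — 20/20 admissible `d`: RHS false every time (2-Selmer PROPAGATION: all local norm indices vanish for odd silent `d` [cite: Kramer1981, Prop. 1]
  + Mazur's `i₂ = 0`, so `dim Sel₂(W^d) = dim Sel₂(W) = 2`); net reading: AN-43 as typed = [(R1) with the `v₂(L^alg(W))` term ∧ κ = 0] ∧ [2-Selmer propagation when `Ш(W)[2] ≠ 0`];
  REF1's optional hygiene C′ (`Nat.card (W.selmerGroup 2) = 1` as an extra hypothesis) is NOT required for truth and NOT filed.  REF2 v57-add1 (2a4aae0b3dae9488) / v58 §2: NOT IN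
  PRINT as stated; = (R1 exact) ∧ BSD₂-parity for the rank-0 members of the N-inert imaginary twist family («expected»); NEW-COMBINATION, downgrade trigger = Antoniadis–Bungert–Frey
  1990 §3 (acq-14732; per Chida 2005 and Delaunay–Roblot they compute `Sel₂` of prime twists of 11a/17a); AN-43z (all `p ∣ d` 3-cycle primes, `d` odd) ⟸ IN PRINT IN SUBSTANCE
  [cite: Zhai2016, Thm. 1.1] — to be split off as a cited theorem at -an's next typing (not done here: no sketch); nearest print for the mechanism: Gross 1987, Böcherer–Schulze-Pillot,
  [cite: OnoSkinner1998, Thm. 1], Kriz–Li 2019 (indefinite side), Tian–Yuan–Zhang (CM prototype).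
* **AN-43⁻ `OddToricPeriodOfSelmerTrivial`** (`@[conjecture]`; the ⟸ half, feeding the line's input `S_rankZeroTwin`) — SURVIVES + R232c; kernel: `law → AN-43⁻` (-an).
* **T1 `ToricPeriodGenusVanishing`** (PLAIN; theorem-candidate) — an odd `p ∣ d` inert in `ℚ(√−N)` ⟹ period EVEN; mechanism = the reflection `ρ` is fixed-point free iff the Frobenius
  reflection class misses the principal genus (MEMO-an §28.4; census criterion 2292/2292, conclusion 984/984, |Fix ρ| = 2^(t−1)·[genus] exact 1156/1156).  REF2 v58 §2: for ODD `d`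
  IN PRINT IN SUBSTANCE on the modular-symbol side [cite: Zhai2016, Thm. 1.6] (after (R1)); for EVEN `d` not in any Zhai paper; the definite-side genus-theory proof is not found
  stated for non-CM `W` — corollary-of-print (Gross §3 + genus theory), small beyond-print YES for even `d`.
* **T1⁺ `ToricPeriodVanishingAtTwo`** (PLAIN) — `8 ∣ d`, `Δ < 0` ⟹ period even (1296/1296 + 608/608).  REF2 v58 R58a: NO prime-conductor curve with `Δ < 0`, `2 ∣ a₂`, `N ≡ 7 (mod 8)`
  exists (supersingular at 2 ⟹ level-2 fundamental character ⟹ `Δ ≡ 5 (mod 8)·□` [cite: Conrad1997Flat, Thm. 1.1 (PDF p. 446)]; REF2 v58-add1 §A: IN PRINT VERBATIM as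
  [cite: CalegariEmerton2009, Lemma 13] «if ρ̄ is supersingular at two and not totally real then N ≡ 3 mod 8», prime conductor, arXiv math/0503359 p. 5 — verified by the typer) — -an's
  falsifier cell is EMPTY (R232e superseded);
  R58d: `∏_{odd p∣d}(−N/p) = (−N,d)₂` (Hilbert reciprocity) ⟹ the `a₂`-even part of T1⁺ is a COROLLARY of T1 (1497/2811 even-`d` rows, 0 violations); the beyond-T1 content of
  T1⁺/T1⁺ᵃ/T1⁺ᵇ is ONE `Prop` «`2 ∤ a₂ → 2 ∣ d → ¬OddToricPeriod`» on the free cells (515 rows, 11 classes), open mechanism only at `8 ∣ d ∧ N ≡ 7 (mod 8)` (431, 503) — -an's next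
  typing (REF2 §4 (iii)), not invented here; R58e: `c₂(W^{(d)}) = 3 + (−N,d)₂` for `2 ∤ a₂` (1112/1112), `= 1` for `2 ∣ a₂` — all of it BSD₂-expected.
* **T1⁺ᵇ `ToricPeriodEvenOfOneModFour`**, **T1⁺ᵃ `ToricPeriodEvenOfOddAp2`** (PLAIN; theorem-candidates with BSD-free proof sketches, MEMO-an §28.3e–f: `M_w ≡ Σ_{Fix ρ} Φ`,
  genus theory + reciprocity at `4 ∥ d`, type-S transvection `Φ(𝔭₂⋆x) ≡ a₂Φ(x)` 154/154, S/F alternation 73/73 + 34/34) — SURVIVE with scope rider R232f (quantified over EVERY `W`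
  of prime conductor `N`; evidence `S₃`-only; rank ≥ 1 trivially; untested corner: Eisenstein-congruent classes, falsifier T43 on 17a at `4 ∣ d`); REF2 v58: NOT IN PRINT (nearest
  mechanism of the same flavour: Ono 2001 mod-`2^s` persistence); THEOREM-CANDIDATES, small beyond-print YES on the free cells; T1⁺ᵇ as a LAW ⊆ T1 ∪ T1⁺ᵃ-extended (R58b).
BRANDT-FREE PREDICTIONS (REF1 BC7-d/e/g/h, kernel sibling): Law ∧ T1⁺ / T1 / T1⁺ᵇ / T1⁺ᵃ ⟹ on the corresponding rows NOT (`Sel₂(W') = 1 ∧ ∏c(W')` odd) — LMFDB-column falsifiers for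
-data, no quaternion arithmetic.

DATA = BC5 WITNESS (MEMO-an §28; `MEMO-an-data/g25/` SHA16.txt; numbers not adjectives): engine T43 `jobT43x/t43.gp` a45a6a4a0134adbc (PARI: Brandt module via ternary `qfrep` on
Gross lattices; kit j334240: 12/13 curves N ≤ 503, Δ < 0, −d ≤ 1200 — law 2116/2116, ⟸ 729/729, `L(W^{(d)},1) = 0 ⟹ period 0` 385/385; extension j334621: 28 classes N ≤ 2000,
−d ≤ 2000, 8508 rows, law 7900/7900 on Δ < 0, κ constant 112/112 cells = `[Δ>0] + [8∣d][2∣a₂]`, T1 3897/3897, T1⁺ 1296/1296) and ENGINE 2 `jobT43e2/t43e2.py` c2c48edf5cf36b8c (Sage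
`BrandtModule(N)` Hecke row-eigenvector + Gross lattices; j334653: 2307/2307 agreement); reflection census j334838 (|Fix ρ| = 2^(t−1)·[genus] 712/712), η-types j334876/j334921
(P1 154/154, alternation 98/98).  CHEAPEST FALSIFIERS: REF1 §232 — T43 at 571a1 (prediction: every `M_w` even; an odd one refutes (R1)+Gross normalisation); -data: the BC7-d/e/g/h
LMFDB rows; T1⁺ᵃ/ᵇ: 17a at `4 ∣ d` (Eisenstein corner).

PARTITION: none moved (AN-43 conjecture-grade new-combination; T1 family theorem-candidates / corollary-of-print).  Beyond-print theorem: no.  BSD is not proved by this; 23715 is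
not closed.  bears_on: stmt-BirchSwinnertonDyer-23715 (crux `RankOneAtTwoBigImageOddLocal`: AN-43⁻ is the definite-side reformulation of the line's `S_rankZeroTwin` input for
the twin `W^{(−q)}`, MEMO-an §28.5/§28.10 (e)).

v3 ADDENDUM (typer -ty g20): APPENDED -an g26's §29 rows from `MEMO-an-data/g26/Sketch_g26_v7.lean` **df87c63c6dfa9716** (= the tree crux workfile `DefiniteMod2WaldspurgerAN43.lean`
after -an g26; = v5 + ten NEW defs; the eight v5 bodies above are byte-identical in v7 — builder-checked): the AXIS-LEMMA section docstring and `ToricPeriodEvenOfEightDvd` (T1⁺ at `8 ∣ d` complete, every prime `N`, `d < −8`),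
`ToricPeriodEvenOfEvenApRamified` (T1♯, the ramified-prime rung at `N ≡ 3 (mod 4)`), `ToricPeriodEvenOfEvenApRamifiedOneModFour` (T1♯ at `N ≡ 1 (mod 4)`, conditional on an odd
class order), `OddApTwoOfPrimeConductor` and `EvenApOfInertInFrobeniusField` (CFT placement of the 2-division field, support/classical), and CONJECTURE (D)
`ModTwoToricValuesOnFrobeniusTorsor` (`@[conjecture]`), and (v7) `ToricTorsorRelation` (TR), `ModTwoToricCosetStructure` (D0), `ModTwoToricVanishingOfSupersingular` (D0-ss)
(theorem-candidates), `ModTwoToricNonvanishing` (D1, `@[conjecture]`) — VERBATIM, riders appended; the sketch's note (E) `toricParityReciprocity_note : True` is folded as text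
into the v6 section docstring; the glue theorems `toricPeriodVanishingAtTwo_of_eightDvd` (T1⁺-complete ⟹ T1⁺ on `d < −8`) and `modTwoToricVanishingOfSupersingular_of_D`
((D) ⟹ (D0-ss)) go to the kernel sibling.  PORT GATE for the §29 rows = REF1-AUDIT §243 (-ref1 g22, 2026-08-29T20:16:05Z; tree `lean check` of the crux workfile rc 0, 24 `dupNamespace` warnings — R243b: re-namespaced
here exactly as v1, statements verbatim; portcheck243: the 11 old decls 11/11 IDENTICAL to v5; BC7 probes P1 (CFT (i)/(iii) on 8774 prime-discriminant models: 0/2382 and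
0/70 052 violations), P2 ((D0)'s finite-group lemma exact, 43/43 + ss-variant 60/60), P3 (class-number inputs of the AXIS LEMMA: `h(−N)`, `h(−4N)` odd for the 99 primes
`N ≡ 3 (4)`, `N ≤ 1200`)): **ALL TEN SURVIVE, 0 KILLED** — CFT (i)/(iii) COROLLARY-OF-PRINT; T1⁺-complete, T1♯ (both forms), (TR), (D0), (D0-ss) THEOREM-CANDIDATES with complete
sketches; (D), (D1) CONJECTURES (`@[conjecture]`); riders R243a (CFT (iii) hypotheses possibly unnecessary), R243b (port hygiene — done), R243c (`d = −8` census-only cell),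
R243d ((D) from (D0)+(D1) needs «`Φ(x_τ)` even»), R243e ((E)/(D1) untested at `Δ > 0`).  REF2 PLACEMENT = v58-add2 §G (pre) + v58-add3 §J (33dc762dd4772de6): (TR), (D0),
(D0-ss), CFT (i),(iii) corollary-of-print / routine (CFT (i) = [cite: CalegariEmerton2009, Lemma 13] verbatim); T1♯, T1♯(1 mod 4 | odd ord), T1⁺(8∣d) theorem-candidates BEYOND
PRINT (new-combination; audit of the §29.2 `p = 2` axis step owed = ASK AN-G26-2; ASK AN-G26-1 = add the unconditional T1♯ law-row as a conjecture decl); (D1), (D) conjectures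
(new-combination, provisional); (E) conjecture, untyped.  AXIS LEMMA (§29.2, the v6 section docstring below, not a decl): the axis/translation picture is in print
([cite: Vatsal2003, §5]; Vatsal 2002, Cornut–Vatsal), the MOD-2 periodicity reading is new (elementary).  Beyond-print theorem for the cell: STILL NO landed one; live
YES-candidates = T1♯ / T1⁺(8∣d) here and C1′/C6 modulo (I1) (D-imc-60).  DATA for the §29 rows (-an g26, `MEMO-an-data/g26/`): scriptA_out.txt 336237359a396ac6 (26 classes
Δ < 0, 7934 rows: T1♯ 946/0, 663 not covered by T1/T1⁺; residue 615/0; N ≡ 1 (4) 60/0), T44 kit j335299 (t44.py 81628b03a45a5375 → rows/t44_out_j335299.txt 3aac25dbbe6bcd30;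
fold ana/foldT44_out.txt 830e2ea9cd7021b7: ZERO 15/15 ss, COSET-OK 32/32, `x_τ` unique 42/42, engines MATCH 47/47).

v4 TOMBSTONES (typer -ty g20): the two v3 conjecture rows (D) `ModTwoToricValuesOnFrobeniusTorsor` and (D1) `ModTwoToricNonvanishing` were REFUTED AS TYPED by the planner's own
falsifier run T45 minutes after REF1 §243 and after v3 was filed (p743015); under the tree rule «append-only: deprecate, don't mutate» (my v3′ p744909 removing them BOUNCED) they are
KEPT VERBATIM as WITHDRAWN tombstones — docstrings marked, `@[conjecture]` replaced by `@[deprecated]` (a refuted statement is not an obligation node; precedent O5 `GrowthLaws` T10) —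
and the REPAIRED rows of -an g26's v8.1 are appended below.

v4 ADDENDUM (typer -ty g20): APPENDED -an g26's §29.9–§29.14 rows from the crux workfile v8.1 (`Cruxes/RankOneAtTwoBigImageOddLocal/DefiniteMod2WaldspurgerAN43.lean`
12f50d8f35088a7f, commit 10c3bd70edeb; MEMO-an v1.75): `ToricCriterion W d` (the χ-criterion, a `def` with parameters), (H⁻) `ToricPeriodEvenOfSomeEvenAp`, (H⁼)
`ToricParityConstantOnCubicFamily` (theorem-candidates), (H) `OddToricPeriodCriterion` and (Hᵀ) `ToricTamagawaParityLaw` (CONJECTURES, `@[conjecture]` — the parity law «`m_d` odd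
⟺ χ-criterion / Tamagawa form», the cell's answer-candidate to «what is the ± object at 2»), (D1)ʳ `ModTwoToricNonvanishingR` (the REPAIRED non-vanishing conjecture, `r_an = 0 ∧
#Sel₂ = 1`) and the dictionary `ModTwoToricNonvanishingIffOddLValue` (`@[conjecture]`; T45 × T46 77/77), T1⁺-merged `ToricPeriodEvenOfOddApTwoEvenDisc` («`2 ∤ a₂ → 2 ∣ d →
¬OddToricPeriod`», REF2 v58 §4 (iii)) and `AxisRecursionAtTwo` (the `p = 2` axis recursion, ASK AN-G26-2) (theorem-candidates) — VERBATIM, riders appended; the v8 glue theorems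
(`toricPeriodEven_of_criterion`, `toricParityConstant_of_criterion`, `modTwoToricNonvanishingR_of_iff`, `toricPeriodEvenOfOddApTwoEvenDisc_of`) go to the kernel sibling.
PORT GATE for these rows = REF1-AUDIT §252 (-ref1 g22, 2026-08-29T21:13:30Z; audit of the crux workfile v8.1 10c3bd70edeb + memo29b: 24/24 v7 decls identical, 13 new decls read;
law (H) census RE-FOLDED from RAW t43x rows with REF1's own `a_p` code: 7900 rows `d < −4`, 2434 odd, 0 violations; T46 1855/1855 and 2783/2783; `c₂` dictionary 703/703 + {2: 430,
4: 362}; REF2 R58e formula 792/792; T45 91/39/0, 77/77; Probe252.lean c83fb728424bfe74 rc 0): **(H⁻), (H⁼) theorem-candidates SURVIVE; (H), (Hᵀ), (D1)ʳ, Iff conjectures SURVIVE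
(`d < −4` necessary); `ToricCriterion` faithful; `ToricPeriodEvenOfOddApTwoEvenDisc` + the sanity theorems correct pure logic; `AxisRecursionAtTwo` (i) SURVIVES, (ii) VACUOUS (R252a:
prime conductor `N ≡ ±1 (mod 8)` forces `a₂` odd — ported verbatim, restatement left to -an g27); R252b (79.a1 falsifier for the axis argument), R252c ((Hᵀ) and `d ∈ {−3, −4}`:
Gross's unit index).**  REF2 PLACEMENT = v58-add5 §M (07d…): (H)|odd d, Selmer slaving|odd d (Mazur–Rubin 2010 lemma), CFT rows, (TR), (D0), (D0-ss), AxisRecursionAtTwo →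
corollary-of-print / routine (odd-d AN-43 = print-in-substance: Zhai 2016 + MR10 + Boxer–Diao, modulo (R1) on the toric side); (H⁻), (H⁼), T1♯, T1⁺(8∣d), OddApTwoEvenDisc →
beyond-print theorem-candidates ((G) POSITION-LEMMA mechanism = NEW-MECHANISM-CANDIDATE, critic to rule); (H)|even d, (Hᵀ), (D1)ʳ, dictionary, (E) → conjecture (new-combination;
the supersingular `4 ∥ d` criterion cell 324/324 = headline beyond-print prediction); asks AN-G27-1 (type «Selmer slaving» for odd criterion `d` as a theorem-candidate citing MR10
— a statement for -an g27 to sketch), AN-G27-2 ((D1)ʳ ⟺ `L^alg(E/F)/L^alg(E)` a 2-unit, kit), AN-G27-3 (P29 groups vs Kedlaya–Medvedovsky 2019).  Beyond-print theorem LANDED: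
none; BSD not proved.  DATA (-an g26 s4, MEMO-an v1.75 §29.9–§29.15; `MEMO-an-data/g26s4/`): T45 kit j335467 (t45.py c96cfbd7d044fd2a; foldT45_out.txt), T46 kit j335666
(foldT46_out.txt), P29 scan (p29scan.py 12ff402a7d05939f).
-/

namespace Summit.BirchSwinnertonDyer.Rank1Residual.F1Sign2.ANg25

open Literature.NumberTheory.Automorphic Literature.NumberTheory.Automorphic.Brandt
open Literature.NumberTheory.EllipticCurves
open scoped NumberField nonZeroDivisors

/-- `OddToricPeriod W N K`: on SOME definite set-up `S` of discriminant `N` and level `1`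
(`Brandt.XiSetup 1 N`, maximal order `S.O` in the quaternion algebra `S.D` ramified at `N, ∞`),
SOME generator `φ` of the Hecke eigen-line of `W` in `ℤ[Cls S.O]`
(`Brandt.eigenLattice N (Brandt.matrix S.O) (a_p(W))_p = ℤ ∙ φ`, eigenvalues `a_p(W)` =
`W.frobeniusTrace p` at the primes `p ∤ N`) and SOME Gross point `(ψ, I)` of conductor `1` of `K`
(`Brandt.IsGrossPoint S.O ψ I`), the WEIGHTED toric period `Σ_{𝔞 ∈ Cl K} (w·φ)(𝔞 ⋆ (ψ, I))`
(`Brandt.toricPeriod S.O ψ I (w·φ)` = Gross 1987 §§3,11 `⟨e_f, Σ_σ x^σ⟩ = Σ_i w_i φ_i c_i`) is ODD.  The parity does not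
depend on the choices (φ up to sign; the two `Pic(𝓞_K)`-orbits of Gross points are swapped by
`ψ ↦ ψ ∘ conj`, which preserves `[I]`), so "∃" = "∀" here; with no set-up / no eigen-line / no Gross
point (e.g. `N` not prime, `N` split in `K`) the predicate is `False`.
(RIDER, typer -ty g20: PLAIN `def` with parameters — the parity carrier of all rows below.  REF1-AUDIT §232 A2: interfaces are GENUINE tree
constructions (`XiSetup 1 N`, `eigenLattice` — binds `T_p v = a_p v` for primes `p ∤ N` ONLY —, `Brandt.matrix`, `weight c = #(leftOrder c)ˣ/2`, `IsGrossPoint`,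
`toricPeriod = Σ_{𝔞 ∈ ClassGroup 𝓞_K} evalAtLattice φ (grossTranslate ψ 𝔞 I)`); `∃ (_ : Fintype …)` ranges over a `Subsingleton` — harmless.  **R232a** (documentation
rider, choice-freeness): SIGN ✓ kernel (`ANg25.Kernel.toricPeriod_neg`, `odd_weightedPeriod_neg_iff`; `Brandt.eq_or_eq_neg_of_span_eq` gives `φ` up to sign); SET-UP ✓ on
paper (maximal orders of the definite algebra of prime discriminant are locally conjugate, class sets in canonical bijection); ORBIT (`ψ ↦ ψ ∘ conj` swaps the two
`Pic(𝓞_K)`-orbits and multiplies the period by the `T_N`-sign of `φ`) ✓ on paper GIVEN `T_N φ = ±φ`, which holds for the newform line by multiplicity one at prime level but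
is NOT stated by `eigenLattice` — parity is sign-blind either way, so no truth-value ambiguity.  A3/A4: with no set-up the predicate is `False` (kernel
`ANg25.Kernel.not_oddToricPeriod_of_isEmpty`, `nonempty_setup_of_oddToricPeriod`), so the VANISHING rows and the ⟹ half of the law are not junk-provable and the ⟸ half
ASSERTS existence (D-0015 bar met).  CONVENTION NOTE of the sketch (`oddToricPeriod_convention_note`, folded here as text; decided by the T43 data, 11a1 / d = −15): with `φ` a
generator of the `mulVec` eigen-line of Voight's `T(n)` (= coordinates of Gross's `e_f = Σ φ_i e_i`), Gross's special-value quantity is the PAIRING `⟨e_f, e_K⟩ = Σ_i w_i φ_i c_i(K)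
= Σ_𝔞 (w·φ)(𝔞 ⋆ x)`, i.e. `toricPeriod` of the WEIGHTED function `w·φ` (the eigenvector of the transposed action) [cite: Gross1987Heights, §3 and §11]; the unweighted
`toricPeriod S.O ψ I φ = Σ_i φ_i c_i` vanishes at (11a1, d = −15) although `L(E,1)·L(E^{(−15)},1) ≠ 0`, so it is not the Waldspurger period — hence the weight (R232b: Gross's
prime-level convention `⟨e_i,e_j⟩ = w_i δ_ij` ✓ consistent with `BrandtGrossPoints`).  The Frobenius reflection `ρ = τ_c ∘ σ_N` of the T1 mechanism is the tree's
`Brandt.grossReflect` (`Literature/NumberTheory/Automorphic/BrandtGrossPointReflection.lean`, p739374); REF1 §236 R236a: `ρ` is an involution on CLASSES only — a stub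
«`M_w ≡ Σ_{Fix ρ}(wφ) (mod 2)`» must type `Fix ρ` on the Gross SET of orbits/classes, not on raw pairs.) -/
def OddToricPeriod (W : WeierstrassCurve ℚ) [W.IsGloballyMinimal] (N : ℕ)
    (K : Type) [Field K] [NumberField K] : Prop :=
  ∃ (S : Brandt.XiSetup 1 N) (_ : Fintype (Brandt.ClassSet S.O)) (φ : Brandt.ClassSet S.O → ℤ)
    (ψ : K →ₐ[ℚ] S.D) (I : Submodule ℤ S.D),
    φ ≠ 0 ∧
    Brandt.eigenLattice N (Brandt.matrix S.O) (fun p => W.frobeniusTrace p) = ℤ ∙ φ ∧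
    Brandt.IsGrossPoint S.O ψ I ∧
    Odd (Brandt.toricPeriod S.O ψ I (fun c => (Brandt.weight S.O c : ℤ) * φ c))

/-- **Construction statement (kept separate from the interface, D-0019):** for a prime `N` and
an elliptic `W` of conductor `N` there IS a definite set-up of discriminant `N`, level `1`, whose
Hecke eigen-lattice for `(a_p(W))_{p ∤ N}` is a line (Eichler / Jacquet–Langlands + strong
multiplicity one; Gross 1987 §§1–5).  Under it the `∃` in `OddToricPeriod` can be read `∀`
(parity is choice-free).  Not in the tree; the ⟸ half of AN-43 needs it, T1 does not.
(RIDER, typer -ty g20: PLAIN construction statement (the crux rows take it as an input where needed; T1-type rows do not).  REF1-AUDIT §232: **SURVIVES** —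
print: Eichler / Jacquet–Langlands + strong multiplicity one [cite: Gross1987Heights, §1–§5]; the rank-one ℤ-lattice formulation is right; it would be FALSE for an `N` with no
weight-2 newform of that Hecke field — excluded by `conductorNorm = N` + modularity.  REF2 v57-add1: construction, in print.) -/
def DefiniteEigenLineExists : Prop :=
  ∀ (W : WeierstrassCurve ℚ) [W.IsElliptic] [W.IsGloballyMinimal] (N : ℕ),
    N.Prime → W.conductorNorm ℤ = N →
    ∃ (S : Brandt.XiSetup 1 N) (_ : Fintype (Brandt.ClassSet S.O)) (φ : Brandt.ClassSet S.O → ℤ),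
      φ ≠ 0 ∧ Brandt.eigenLattice N (Brandt.matrix S.O) (fun p => W.frobeniusTrace p) = ℤ ∙ φ

/-- **AN-43 (candidate law; mod-2 Waldspurger on the definite side, κ = 0 regime).**
For `W/ℚ` globally minimal of PRIME conductor `N`, analytic rank `0`, `ρ̄_{W,2}` onto
`GL₂(𝔽₂) ≅ S₃`, negative discriminant, and `K` imaginary quadratic of discriminant `d < -4` with
`N` inert in `K` (`jacobiSym d N = -1`): the toric period is odd iff the twist `W^{(d)}` has
trivial `2`-Selmer group and odd Tamagawa product (on a globally minimal model `W'` of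
`W.quadraticTwist d`).  (When `8 ∣ d` and `a_2(W)` is even both sides are always false: the fitted
2-adic Gross–Waldspurger constant is κ = 1 there; for `Δ > 0` the law needs κ ≥ 1 and is NOT
claimed — 37b1: 18 counterexamples to the κ = 0 form, all with `8 ∣ d`.)  Census j334240
(sha16 7e0b312a40e10530): 12 curves (N ≤ 503, Δ < 0, a_2 of both parities, incl. Kilford's
N = 431, 503) × fundamental `-d ≤ 1200`, `d < -4`: 2116/2116 instances, 0 violations, both
directions (⟸: 729/729; L(W^{(d)},1) = 0 ⟹ period 0: 385/385 over all 13 curves).  [conjecture; NOT in print in this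
form — nearest: Tian–Yuan–Zhang 2017 Thm 1.1 (CM, N = 32), Zhai 2016 / Cai–Li–Zhai 2020 (modular
symbols, ⟹ on sub-families), Kriz–Li 2019 (indefinite side)]
(RIDER, typer -ty g20: `@[conjecture]` — CONJECTURE-GRADE, NEW-COMBINATION (REF2 v57-add1 2a4aae0b3dae9488 / v58 §2: NOT IN PRINT as stated; = (R1 exact) ∧
BSD₂-parity for the rank-0 members of the `N`-inert imaginary twist family, «expected»; downgrade trigger = Antoniadis–Bungert–Frey 1990 §3 (acq-14732: 2-Selmer of prime
twists of 11a/17a); the sub-family AN-43z (`d` odd, every `p ∣ d` a 3-cycle prime, i.e. `a_p` odd) has its ⟸ direction IN PRINT IN SUBSTANCE [cite: Zhai2016, Thm. 1.1]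
(hypotheses as printed: `E` `Γ₀(C)`-optimal, `Δ < 0`, `E[2](ℚ) = 0`, `ord₂ L^alg(E,1) = 0`, `M = εq₁…q_r ≡ 1 (mod 4)`, `q_i` inert in the cubic field of the 2-division
polynomial ⟹ `ord₂ L^alg(E^{(M)},1) = 0`) — to be SPLIT OFF as a cited theorem at -an's next typing, not here (no sketch); nearest print for the mechanism: Gross 1987,
Böcherer–Schulze-Pillot, [cite: OnoSkinner1998, Thm. 1], Kriz–Li 2019 (indefinite side), Tian–Yuan–Zhang 2017 (CM prototype)).  REF1-AUDIT §232: **SURVIVES with ONE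
substantive rider R232c** — the census generator is a coefficient BOX (`a₄ ∈ [−40,40]`, `a₆ ∈ [−100,100]`): all 29 base classes have `v₂(L^alg(W)) = 0`, i.e. NO census curve
has `Ш(W)[2] ≠ 0`, and -an's bookkeeping (R1) `2·v₂(M_w) − v₂(Ш_an∏c)(W^{(d)}) = κ` is fitted there only; Gross's formula carries `L(W,1)` (`M_d² ≐ c_W·2^κ·L^alg(W)·L^alg(W^{(d)})`,
`u_d = 1` for `d < −4`), so the general reading is `2·v₂(M_w) = v₂(L^alg(W)) + v₂(Ш_an∏c(W^{(d)})) + κ` (ask to -an: restate (R1) so); at an in-frame `W` with `Ш(W)[2] ≠ 0`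
every `M_w` is EVEN and AN-43 holds iff the RHS is false for EVERY admissible `d` — a 2-Selmer PROPAGATION statement.  REF1 entered that regime at **571a1** =
`[0,−1,1,−929,−10595]` (`N = 571` prime ≡ 3 (mod 8), `Δ = −571`, `S₃`, `r_an = 0`, `a₂ = 0`, `L/Ω = 4.000000` by REF1's pure-python engine `twistL571.py` 1d8f04d10b0bab4d):
**20/20 admissible rows** (16 odd `d ≤ 227` incl. every silent one + 4 rows `4 ∥ d`; `L^alg(W^d) ∈ {0, 4, 16, 36}`) ⇒ RHS false every time ⇒ the law is TRUE there with BOTH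
SIDES CONSTANTLY FALSE; why (paper): for odd silent `d` all local norm indices vanish [cite: Kramer1981, Prop. 1] + Mazur's `i₂ = 0`, hence `dim Sel₂(W^d) = dim Sel₂(W) = 2`;
net: AN-43 as typed = [(R1) with the `v₂(L^alg(W))` term ∧ `κ = 0`] ∧ [2-Selmer propagation when `Ш(W)[2] ≠ 0`], both conjuncts holding on everything REF1 can compute.
R232d: `W.analyticRank = 0` is necessary (`r_an ≥ 1` ⇒ all periods vanish ⇒ ⟸ false) and present ✓; `W.Δ < 0` carries κ's `[Δ>0]` bit, the `[8∣d][2∣a₂]` bit is carried by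
T1⁺.  REF1's OPTIONAL hygiene C′ (add `Nat.card (W.selmerGroup 2) = 1`, the `d = 1` row of the RHS, if the crux is meant to be «mod-2 Waldspurger» and not also «Selmer
propagation») is NOT required for truth and NOT filed (port = sketch verbatim).  PREDICTION (REF1, Brandt side, one T43 job): `M_w ≡ 0 (mod 2)` for every admissible `d`
at 571a1 — an ODD `M_w` there refutes (R1)-with-term and Gross-normalisation `v₂(c_W) = 0` simultaneously.) -/
@[conjecture] def DefiniteMod2WaldspurgerLaw : Prop :=
  ∀ (W : WeierstrassCurve ℚ) [W.IsElliptic] [W.IsGloballyMinimal] (N : ℕ),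
    N.Prime → W.conductorNorm ℤ = N → W.analyticRank = 0 →
    W.HasSurjectiveModNGaloisRep 2 → W.Δ < 0 →
    ∀ (K : Type) [Field K] [NumberField K] (d : ℤ), IsImaginaryQuadratic K →
      NumberField.discr K = d → d < -4 → jacobiSym d N = -1 →
    ∀ (W' : WeierstrassCurve ℚ) [W'.IsElliptic] [W'.IsGloballyMinimal] (C : WeierstrassCurve.VariableChange ℚ),
      C • W' = W.quadraticTwist (d : ℚ) →
      (OddToricPeriod W N K ↔ (Nat.card (W'.selmerGroup 2) = 1 ∧ Odd W'.tamagawaProduct))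

/-- **T1 (genus vanishing; the elementary rung of AN-43).**  Same `W, N, K, d` (any sign of
`Δ`, any image): if some ODD prime `p ∣ d` is inert in `ℚ(√-N)` (`jacobiSym (-N) p = -1`),
the toric period is EVEN.  Mechanism: the involution `(ψ, I) ↦ (ψ ∘ conj, I·𝔓_N)` on a
`Pic(𝓞_K)`-orbit of Gross points is of reflection type, preserves `φ` mod 2 (`w_N φ = ± φ`), and is
fixed-point free exactly when the Frobenius reflection class of `N` in `Gal(H_K/ℚ)` misses the
principal genus, i.e. iff such a `p` exists (census: criterion ⟺ "no odd inert `p ∣ d`",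
2292/2292; conclusion 984/984).  BSD-consistency: each such `p` has `c_p(W^{(d)}) = 2`.
[claimed provable from the tree's Gross-point API + genus theory; not found in print for
non-CM `W` — CM prototype: Tian–Yuan–Zhang 2017 (genus periods)]
(RIDER, typer -ty g20: PLAIN theorem-candidate.  REF1-AUDIT §232: **SURVIVES** (claimed corollary-of-print, MEMO-an §28.4; a vanishing statement, unaffected by R232c;
kernel BC7-e `ANg25.Kernel.rhs_false_of_law_of_genusVanishing` = the Brandt-free prediction of Law ∧ T1).  REF2 v58 §2: for ODD `d` IN PRINT IN SUBSTANCE on the modular-symbol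
side [cite: Zhai2016, Thm. 1.6] (`Δ < 0`, `L(E,1) ≠ 0`, `M ≡ 1 (mod 4)`, some `q_i` with `ord₂ N_{q_i} > −ord₂ L^alg(E,1)` ⟹ `ord₂ L^alg(E^{(M)},1) ≥ 1`; an inert odd prime
has `a_q` even), after the κ-bookkeeping (R1); for EVEN `d` NOT in Zhai 2016 nor in [cite: Zhai2021BSDExactFormulaTwists, Thm. 1.1] (`M ≡ 1 (mod 4)` throughout); the
definite-side genus-theory proof is NOT FOUND STATED for non-CM `W`; grade: corollary-of-print (Gross 1987 §3 + genus theory), theorem-candidate, small beyond-print YES for even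
`d`.  REF2 v58 R58d (reciprocity lemma, a theorem): `∏_{odd p∣d}(−N/p) = (−N, d)₂`, so «σ = −1» ⟹ an odd number of inert odd primes ⟹ this row applies — 1497/2811 even-`d`
rows «forced», 0 violations.  Mechanism objects in the tree: the reflection `Brandt.grossReflect` with `act_mul_normPrimeIdeal = S.wMinus`, `toricPeriod_reflect`,
`act_reflect` (p739374); R236a (type `Fix ρ` on classes).) -/
def ToricPeriodGenusVanishing : Prop :=
  ∀ (W : WeierstrassCurve ℚ) [W.IsElliptic] [W.IsGloballyMinimal] (N : ℕ),
    N.Prime → W.conductorNorm ℤ = N →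
    ∀ (K : Type) [Field K] [NumberField K] (d : ℤ), IsImaginaryQuadratic K →
      NumberField.discr K = d → d < -4 → jacobiSym d N = -1 →
      (∃ p : ℕ, p.Prime ∧ p ≠ 2 ∧ (p : ℤ) ∣ d ∧ jacobiSym (-(N : ℤ)) p = -1) →
      ¬ OddToricPeriod W N K

/-- **T1⁺ (vanishing at the prime 2; -an g25 extension census kit j334621):** when `8 ∣ d`
(the twist `W^{(d)}` is additive at 2) the weighted toric period is EVEN — 1296/1296 rows on 26
prime-conductor classes with Δ < 0 (N ≤ 1979, −d ≤ 2000), INCLUDING the 163 rows where no odd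
`p ∣ d` is inert in `ℚ(√−N)` (so this is not a case of `ToricPeriodGenusVanishing`); and 608/608
rows on the two Δ > 0 classes for every d.  Mechanism OPEN (candidates: the free action of the
ramified prime over 2 on the fixed points of the Frobenius reflection).  BSD-side counterpart: for
`8 ∣ d` either `c₂(W^{(d)})` is even or an odd number of transposition primes divides `d`.
Stated for Δ < 0 only (the typed frame of AN-43).
(RIDER, typer -ty g20: PLAIN.  REF1-AUDIT §232: **SURVIVES** (R232e: -an's own falsifier cell «`Δ < 0`, `N ≡ 7 (mod 8)`, `2 ∣ a₂`: BSD₂ predicts ODD periods at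
`8 ∣ d`» untested in the census) — SUPERSEDED by REF2 v58 **R58a** (a lemma in print): good SUPERSINGULAR reduction at 2 (⟺ `2 ∣ a₂`, `N` odd) ⟹ inertia at 2 acts on `W[2]`
through the fundamental character of level 2 [cite: Conrad1997Flat, Thm. 1.1] (PDF p. 446; Serre 1972 §1.11), so `ℚ₂(W[2])` has group `S₃` with UNRAMIFIED resolvent, i.e.
`Δ_W ≡ 5 (mod 8)·□`; with `Δ_W = ±N^k`: `Δ_W < 0 ⟹ N ≡ 3 (mod 8)`, `Δ_W > 0 ⟹ N ≡ 5 (mod 8)` (census 17/17) — IN PRINT VERBATIM (REF2 v58-add1 §A):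
[cite: CalegariEmerton2009, Lemma 13] «if ρ̄ is supersingular at two and not totally real then N ≡ 3 mod 8» (prime conductor `N`, `ρ̄ = W[2]` irreducible; proof: the `S₃`
field is a cubic extension of `F = ℚ(√±N)` ramified precisely at 2, possible only if 2 is unramified and inert in `F`) — **the falsifier cell is EMPTY by a theorem, not by census luck**;
the sketch's `toricPeriodVanishingAtTwo_falsifier_note` («a prime-conductor class with `Δ < 0`, `N ≡ 7 (mod 8)` and `a₂` EVEN would have `c₂(W^{(d)})` odd at `8 ∣ d` while
`Fix ρ ≠ ∅` is allowed by genus theory; the census (26 classes, N ≤ 1979) contains no such class; recorded as a data ask, not as a claim») is folded here as text and its data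
ask is VOID (R58a (i)).  R58d: the `a₂`-EVEN part of this row (747/747 rows, all reciprocity-forced) is a COROLLARY of `ToricPeriodGenusVanishing` — zero content beyond T1;
the `a₂`-ODD part = T1⁺ᵃ extended to `8 ∣ d`; the cell with NO mechanism is `8 ∣ d ∧ N ≡ 7 (mod 8)`: 90 rows from TWO classes (431, 503).  R58e (BSD₂ twin, read off the
rows): `c₂(W^{(d)}) = 3 + (−N, d)₂ ∈ {2, 4}` for `2 ∤ a₂` (1112/1112), `= 1` for `2 ∣ a₂` (1699 rows) — Tate's algorithm Step 7 (type `I_n^*`), exact type/`c` table for 2-adic twists: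
Comalada 1994, J. Number Theory 49 (not held, acq-14746) — so the row is BSD₂-EXPECTED everywhere.  REF2 v58 §2 placement: NOT IN PRINT (even `d` is outside every Zhai paper; CKRS 2006 restrict to prime `|d|`); grade:
law = BSD₂-consequence given R58e, theorem-content = the definite-side mechanism on the free cells.  Typing advice REF2 §4 (iii) (merge the `2 ∤ a₂` clauses of T1⁺/T1⁺ᵃ
into ONE `Prop` «`2 ∤ a₂ → 2 ∣ d → ¬OddToricPeriod`», drop «Δ < 0» there) is -an's next typing, NOT done in this verbatim port.  Kernel BC7-d
`ANg25.Kernel.rhs_false_of_law_of_vanishingAtTwo` = the Brandt-free prediction of Law ∧ T1⁺ (LMFDB columns only).) -/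
def ToricPeriodVanishingAtTwo : Prop :=
  ∀ (W : WeierstrassCurve ℚ) [W.IsElliptic] [W.IsGloballyMinimal] (N : ℕ),
    N.Prime → W.conductorNorm ℤ = N → W.Δ < 0 →
    ∀ (K : Type) [Field K] [NumberField K] (d : ℤ), IsImaginaryQuadratic K →
      NumberField.discr K = d → jacobiSym d N = -1 → (8 : ℤ) ∣ d →
      ¬ OddToricPeriod W N K

/-- **AN-43⁻ (the half of AN-43 that feeds the line's input `S_rankZeroTwin`):** trivial
`2`-Selmer group and odd Tamagawa product of the twist force an ODD toric period (hence, by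
Gross's special-value formula, a 2-adic unit `L(W^{(d)},1)·L(W,1)/periods`).  Census: 729/729
(12 curves with Δ < 0); extension kit j334621: 2434/2434 (26 classes N ≤ 1979, −d ≤ 2000).
(RIDER, typer -ty g20: `@[conjecture]` — the ⟸ half of AN-43 (kernel `ANg25.Kernel.oddToricPeriodOfSelmerTrivial_of_law : Law → this`), the definite-side
reformulation of the line's `S_rankZeroTwin` input for the twin `W^{(−q)}` (MEMO-an §28.5/§28.10 (e)).  REF1-AUDIT §232: **SURVIVES + R232c** (see the law's rider: at an
in-frame `W` with `Ш(W)[2] ≠ 0` the hypotheses `Sel₂(W') = 1 ∧ ∏c(W')` odd are never met on REF1's 20 rows at 571a1, so the row is not contradicted there); polarity: it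
ASSERTS the existence of a set-up + eigen-line + odd Gross point whenever its arithmetic hypotheses are met — not junk-provable (the tree constructs no `Brandt.XiSetup`;
kernel BC7-a).  REF2: conjecture-grade with the law (NEW-COMBINATION); its AN-43z sub-family ⟸ is [cite: Zhai2016, Thm. 1.1] in substance after (R1).) -/
@[conjecture] def OddToricPeriodOfSelmerTrivial : Prop :=
  ∀ (W : WeierstrassCurve ℚ) [W.IsElliptic] [W.IsGloballyMinimal] (N : ℕ),
    N.Prime → W.conductorNorm ℤ = N → W.analyticRank = 0 →
    W.HasSurjectiveModNGaloisRep 2 → W.Δ < 0 →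
    ∀ (K : Type) [Field K] [NumberField K] (d : ℤ), IsImaginaryQuadratic K →
      NumberField.discr K = d → d < -4 → jacobiSym d N = -1 →
    ∀ (W' : WeierstrassCurve ℚ) [W'.IsElliptic] [W'.IsGloballyMinimal] (C : WeierstrassCurve.VariableChange ℚ),
      C • W' = W.quadraticTwist (d : ℚ) →
      Nat.card (W'.selmerGroup 2) = 1 → Odd W'.tamagawaProduct → OddToricPeriod W N K

/-- **T1⁺ᵇ (theorem-candidate, -an g25 §28.3e–f; BSD-free proof sketch):** for a PRIME
conductor `N ≡ 1 (mod 4)` and ANY curve `W` of conductor `N`, the weighted toric period of every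
EVEN fundamental `d < -8` with `(d/N) = -1` is even.  Proof sketch: `M_w ≡ Σ_{Fix ρ} Φ (mod 2)`
(ρ = Frobenius reflection `(I, b) ↦ (I𝔐, b)`, `Φ(I𝔐) = a_N Φ(I)`); for `4 ∥ d` genus theory +
reciprocity give `Fix ρ = ∅`; for `8 ∣ d` every fixed point is of type S (an `η ∈ R` with
`ηI = I𝔐`, `ηb = -bη` has `(1+η)/2 ∉ R` since `nrd = (1+N)/4 ∉ ℤ`), so `η mod 2R` is the
transvection `1 + ν` fixing the neighbour `𝔭₂⋆x` and swapping the two conductor-2 neighbours,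
whence `Φ(𝔭₂⋆x) ≡ a₂ Φ(x) (mod 2)` (98/98 numerically, kit j334876); `𝔭₂` is not principal
(`d ≠ -4, -8`), so `Fix ρ` is a union of pairs `{x, 𝔭₂⋆x}` with even `Φ`-sum for either parity of
`a₂`.  Census: every such row of kit j334621 (classes 37.b, 109.a, 701.a, 1297.a, 1321.a,
1373.a, 1901.a; −d ≤ 2000).  Not found in print for non-CM `W`.
(RIDER, typer -ty g20: PLAIN theorem-candidate.  REF1-AUDIT §232 (v5 addendum): **SURVIVES with scope rider R232f** — quantified over EVERY `W` of prime conductor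
`N` (no `S₃` / no-2-torsion / `Δ`-sign / rank hypothesis) while the evidence base is `S₃`-only (7 classes `N ≡ 1 (mod 4)`; 98/98 + 73/73 rows, kit j334876); the proof
sketch uses no image hypothesis, so the scope is defensible; rank ≥ 1 classes satisfy it trivially (`L(W,1) = 0 ⇒ M_w = 0`); UNTESTED corner: Eisenstein-congruent classes
(rational 2-torsion, e.g. `N = 17`, Neumann–Setzer primes `u² + 64`) where `Φ mod 2` meets the Eisenstein vector — cheapest falsifier: T43 on 17a at `d ∈ {−20, −24, −40, …}`
with `(d/17) = −1`; side conditions non-vacuous (kernel BC7-j: `N = 37`, `d = −20`); `d < −8` is exactly the exclusion of principal `𝔭₂` (`d = −4, −8`) ✓.  Kernel BC7-g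
`ANg25.Kernel.rhs_false_of_law_of_oneModFour` (Brandt-free prediction of Law ∧ T1⁺ᵇ).  REF2 v58 §2 / R58b–R58d: as a LAW ⊆ T1 ∪ T1⁺ᵃ-extended ∪ ((R1), `Δ > 0`) — `4 ∥ d` is
100 % reciprocity-forced (264/264; -an's (L4) = R58d), `8 ∣ d` is forced on 132 rows and FREE on 126 (`N ≡ 1 (8) ∧ d/8 ≡ 1 (4)`, `N ≡ 5 (8) ∧ d/8 ≡ 3 (4)`) where the
type-S/P1 argument (L1)–(L2) is load-bearing; as a PROOF ROUTE the cleanest piece; NOT IN PRINT; theorem-candidate; small beyond-print YES (126 free rows, 5 classes with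
`Δ < 0`, + 37.b / 701.a).) -/
def ToricPeriodEvenOfOneModFour : Prop :=
  ∀ (W : WeierstrassCurve ℚ) [W.IsElliptic] [W.IsGloballyMinimal] (N : ℕ),
    N.Prime → W.conductorNorm ℤ = N → N % 4 = 1 →
    ∀ (K : Type) [Field K] [NumberField K] (d : ℤ), IsImaginaryQuadratic K →
      NumberField.discr K = d → d < -8 → jacobiSym d N = -1 → (4 : ℤ) ∣ d →
      ¬ OddToricPeriod W N K

/-- **T1⁺ᵃ at `4 ∥ d` (theorem-candidate, -an g25 §28.3e–f; BSD-free proof sketch):** for a PRIME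
conductor `N` and a curve `W` with `a₂(W)` ODD, the weighted toric period of every fundamental
`d < -4` with `4 ∥ d` and `(d/N) = -1` is even.  Proof sketch: as above `M_w ≡ Σ_{Fix ρ} Φ`; the
LOCAL LEMMA `β/β̄ ≡ 1 + β (mod 2)` for `β = 1 + b/2` (`nrd β ≡ 2 mod 4`) shows that the types of
`x` and `𝔭₂⋆x` ALTERNATE (S/F) along each `𝔭₂`-orbit in `Fix ρ` (73/73 rows, kit j334876), and
the transvection relation at the S-point gives `Φ(x_F) ≡ a₂ Φ(x_S) ≡ Φ(x_S) (mod 2)`.  For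
`2 ∣ a₂` the same argument gives only `Φ(x_F) ≡ 0` (60/60) and `M_w` is odd in 39/51 rows —
matching `c₂(W^{(d)})` odd on the BSD side.  The `8 ∣ d` companion is `ToricPeriodVanishingAtTwo`
(open mechanism only in the cell `N ≡ 7 mod 8`, where all fixed points are of type F and
`𝔭₂⋆x = 𝔪⋆x`, `𝔪` = product of the odd ramified primes).
(RIDER, typer -ty g20: PLAIN theorem-candidate.  REF1-AUDIT §232 (v5 addendum): **SURVIVES + R232f** (scope as for `ToricPeriodEvenOfOneModFour`; `Odd (W.frobeniusTrace 2)`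
forces good reduction at 2 for `N` an odd prime ✓).  Kernel BC7-h `ANg25.Kernel.rhs_false_of_law_of_oddAp2` (Brandt-free prediction of Law ∧ T1⁺ᵃ).  REF2 v58 §2: NOT IN
PRINT; BSD₂-expected (`c₂(W^{(d)}) ∈ {2, 4}`, R58e); the mechanism (types alternate S/F along `𝔭₂`-orbits, transvection relation `Φ(x_F) ≡ a₂Φ(x_S)`) has NO printed
counterpart found (galaxy/corpus g57–g58: 0 relevant; nearest flavour: mod-`2^s` persistence of half-integral-weight coefficients [cite: Ono2001, Thm. 1]); grade:
theorem-candidate, small beyond-print YES for `4 ∥ d` with `N ≡ 3 (mod 4)` (free cells; at `N ≡ 1 (mod 4)` the `4 ∥ d` rows are reciprocity-forced = T1) and for the `8 ∣ d`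
cells with `N ≡ 1 (mod 4)`; OPEN (no mechanism) for `8 ∣ d ∧ N ≡ 7 (mod 8)`.  REF2 §4 (iii) typing advice (merge this `4 ∥ d` clause with T1⁺'s `8 ∣ d`, `2 ∤ a₂` clause into
«`2 ∤ a₂ → 2 ∣ d → ¬OddToricPeriod`», census 1112/1112, beyond-T1 on 515 rows / 11 classes) is -an's next typing, NOT done in this verbatim port; (L0)–(L4), η-types, P1
are elementary lemmas provable in the tree's Brandt API — not literature facts, not conjectures (REF2 v58 §2).) -/
def ToricPeriodEvenOfOddAp2 : Prop :=
  ∀ (W : WeierstrassCurve ℚ) [W.IsElliptic] [W.IsGloballyMinimal] (N : ℕ),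
    N.Prime → W.conductorNorm ℤ = N → Odd (W.frobeniusTrace 2) →
    ∀ (K : Type) [Field K] [NumberField K] (d : ℤ), IsImaginaryQuadratic K →
      NumberField.discr K = d → d < -4 → jacobiSym d N = -1 → (4 : ℤ) ∣ d → ¬ (8 : ℤ) ∣ d →
      ¬ OddToricPeriod W N K

/-! ## v6 (-an g26, MEMO-an §29): axis periodicity, the ramified-prime rung T1♯, the 2-division placement, and the
Frobenius-torsor conjecture

Common mechanism («AXIS LEMMA», §29.2).  For a prime `p ∤ N` realise `Cls S.O = Γ_p \ T_p` (`T_p` the Bruhat–Tits tree of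
`PGL₂(ℚ_p)`, `Γ_p = S.O[1/p]ˣ`; strong approximation), and lift `Φ = w·φ` to a `Γ_p`-invariant function `Φ̃` on vertices with
`Σ_{v' ∼ v} Φ̃(v') = a_p Φ̃(v)` (the Brandt matrix `B(p)` is the adjacency matrix; `w·φ` is ITS eigenvector — T43 convention note).
A point `x ∈ Fix ρ` of the Gross orbit carries `η ∈ R_x = O_L(I_x)` with `η² = -N`, `η ψ(z) = ψ(z̄) η` (§28.3f L0), and
`Φ̃ ∘ η = ε Φ̃` on ALL of `T_p` (`η I_v = I_{ηv} 𝔓_N`, `[I 𝔓_N] = w_N [I]`).  If `k_p := ℚ_p(η)` is split, `Fix(η) ⊇` the axis `A`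
of the torus `k_pˣ`, `η` pairs the off-axis neighbours of every axis vertex (`z ↦ -z` on `ℙ¹(𝔽_p)`; for `p = 2` the single off-axis
neighbour `u_i` is fixed and ITS two far neighbours are swapped), so harmonicity read mod 2 gives the AXIS RECURSION
`Φ̄(v_{i-1}) + Φ̄(v_{i+1}) = ā_p Φ̄(v_i)` (for `p = 2`: `Φ̄(v_i) = ā₂ Φ̄(u_i)` and then the same recursion).  With `ā_p = 0`
the axis values have period 2; a generator `α` of `𝔮^r` (`𝔮 ∣ p` a prime of the order `O_x = k ∩ R_x`, `r = ord [𝔮]` in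
`Pic O_x`) lies in `Γ_p` and translates `A` by `r`; for `N ≡ 3 (mod 4)` both `h(-N)` and `h(-4N)` are odd, so `r` is odd and
`Φ̄` is CONSTANT on `A`.  Finally `v_x ∈ A` and, for the ramified prime `𝔩 ∣ p` of `K = ℚ(√d)`, `v_{𝔩⋆x}` is the ADJACENT axis
vertex (`𝔩⋆x ∈ Fix ρ` with the same `η`; `[L : bL + pL] = p`), so `Φ̄(x) = Φ̄(𝔩⋆x)`; `Fix ρ` is a union of `𝔩`-orbits, of
length 2 when `𝔩` is not principal — whence `M_w ≡ Σ_{Fix ρ} Φ̄ ≡ 0`.  Uses only: quaternion arithmetic, `w_N φ = ±φ`,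
`T_p φ = a_p φ`; valid for EVERY curve of prime conductor `N` (no image / discriminant hypothesis).

FOLDED NOTE (the sketch's `toricParityReciprocity_note : True`, recorded here as TEXT, not typed). **(E) TORIC PARITY RECIPROCITY (conjectural corollary of (D) on both orders `𝓞_k`, `ℤ[√-N]`; -an g26 §29.5; recorded,
not typed — it needs Gross points of conductor 2 for the type-S fixed points).**  For `W` as in (D) and `K = ℚ(√d)`,
`(d/N) = -1`, `d < -4`:  `m_d(W) ≡ #{x ∈ Fix ρ_d : Φ̄|_{X_{O_x}} ≢ 0 and χ_W(𝔞_x) ≠ 1} (mod 2)`, where `x ∈ Fix ρ_d` carries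
`η_x` (`η_x² = -N`), `O_x = ℚ(η_x) ∩ R_x ∈ {ℤ[√-N], 𝓞_k}`, and `𝔞_x ∈ Pic O_x` is the torsor coordinate of `(R_x, η_x)`
relative to `x_τ(O_x)`.  The right-hand side mentions NO L-value and NO eigenvector: `W` enters only through `ℚ(W[2])` and its
ordinarity at 2.  Consequences: (a) T1, T1⁺, T1♯ (the count is over an EMPTY or PAIRED set); (b) two prime-conductor curves
with the same 2-division field and the same reduction type at 2 have `m_d ≡ m_{d}'` (mod 2) for all admissible `d` (no such pair
exists among the 26 census classes — the three supersingular classes of conductor 307 realise the three cubic fields of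
discriminant −1228); (c) via Gross–Waldspurger and BSD₂ it predicts `ord₂ (#Ш(W^{(d)}) · ∏ c_p(W^{(d)}))` from `ℚ(W[2])`
alone.  REF1 R232c's (R1) in this language: `v₂(L^alg(W) · L^alg(W^{(d)})) = 0 ⟺ m_d odd` (Gross), so evenness statements are
statements `2 ∣ L^alg(W)·L^alg(W^{(d)})`.
-/

/-- **T1⁺ at `8 ∣ d`, complete (theorem-candidate, -an g26 §29.2; closes the cell left open in §28.3f / REF2 v58:
`N ≡ 7 (mod 8)`, `2 ∤ a₂`).**  For a PRIME `N`, ANY curve `W` of conductor `N` and every fundamental `d < -8` with `8 ∣ d` and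
`(d/N) = -1`, the weighted toric period is EVEN.  Proof sketch by cells of `k = ℚ(√-N)` at 2: `N ≡ 1 (mod 4)` —
`ToricPeriodEvenOfOneModFour` (type-S transvection); `N ≡ 3 (mod 8)` (`k₂` inert) — `Fix(η)` on `T₂` is the ball of radius 1
around the unique `𝓞_{k,2}`-vertex, `x` and `𝔭₂⋆x` would both be that vertex: `Fix ρ = ∅` (= §28.3f L4); `N ≡ 7 (mod 8)` (`k₂` split,
all fixed points of type F = on the axis) — the AXIS LEMMA above with `p = 2`: `ā₂ = 0` gives `Φ̄ ≡ 0` on the axis outright,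
`ā₂ = 1` gives period 2 + odd translation `r = ord[𝔮₂] ∣ h(-N)`, so `Φ̄(x) = Φ̄(𝔭₂⋆x)` and the `𝔭₂`-pairs cancel (`𝔭₂` not
principal for `d < -8`).  Census kit j334621 (26 classes, N ≤ 1979, −d ≤ 2000): 1296/1296; the 7 rows with `d = -8` are even
too (M_w ∈ {0, ±2}) but are NOT covered by this argument.  Differs from `ToricPeriodVanishingAtTwo` (v5) by dropping `Δ < 0`
and adding `d < -8`.  Not found in print for non-CM `W`.
(RIDER, typer -ty g20: PLAIN theorem-candidate (T1⁺ complete at `8 ∣ d`).  REF1-AUDIT §243: **SURVIVES** — A2 faithful («every `W` of prime conductor, every even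
fundamental `d < −8`, `8 ∣ d`»; no `Δ < 0`, no image hypothesis; at `N ≡ 1 (mod 4)` implied by v5 `ToricPeriodEvenOfOneModFour`); BC7 P3 (pure python, independent):
for the 99 primes `N ≡ 3 (mod 4)`, `7 ≤ N ≤ 1200`, `h(−N)`, `h(−4N)` are both ODD (`h(−4N) = 3h(−N)` at `N ≡ 3 (8)`, `= h(−N)` at `N ≡ 7 (8)`) ⇒ the «odd translation `r ∣ h(O_x)`»
step holds in every case; `𝔭₂` of `ℚ(√d)` non-principal for `8 ∣ d`, `d < −8` ✓.  R243c: `d = −8` is covered by NEITHER this row (`d < −8`) nor a proof sketch, but is still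
CLAIMED by v5's `ToricPeriodVanishingAtTwo` (`Δ < 0`, all `8 ∣ d`; 7/7 rows even) — the one census-only cell left in the T1⁺ column.  REF2 v58-add3 §J.4: cells `N ≡ 1 (4)`
[type-S, v5], `N ≡ 3 (8)` [`Fix ρ = ∅`, §28.3f L4], `N ≡ 7 (8)` [AXIS LEMMA at `p = 2`]; NOT in print for non-CM `W` (v58 §1–2); closes the cell REF2 v58 left open (`N ≡ 7 (8)`,
`2 ∤ a₂`) IF the `p = 2` axis recursion holds — ASK AN-G26-2 (type the `p = 2` axis recursion as a separate lemma); **THEOREM-CANDIDATE beyond print (new-combination)**, same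
standing as T1♯; kernel `ANg25.Kernel.toricPeriodVanishingAtTwo_of_eightDvd` (-an): this row ⟹ v5's `ToricPeriodVanishingAtTwo` on `d < −8`.) -/
def ToricPeriodEvenOfEightDvd : Prop :=
  ∀ (W : WeierstrassCurve ℚ) [W.IsElliptic] [W.IsGloballyMinimal] (N : ℕ),
    N.Prime → W.conductorNorm ℤ = N →
    ∀ (K : Type) [Field K] [NumberField K] (d : ℤ), IsImaginaryQuadratic K →
      NumberField.discr K = d → d < -8 → jacobiSym d N = -1 → (8 : ℤ) ∣ d →
      ¬ OddToricPeriod W N K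

/-- **T1♯ — the ramified-prime rung (theorem-candidate, NEW in -an g26 §29.3).**  For a PRIME `N ≡ 3 (mod 4)`, ANY curve `W`
of conductor `N`, a fundamental `d < -4` with `(d/N) = -1`, and an ODD prime `ℓ ∣ d` that SPLITS in `ℚ(√-N)` (`(-N/ℓ) = +1`)
with `a_ℓ(W)` EVEN and `|d| ∉ {ℓ, 4ℓ}`: the weighted toric period is EVEN.  (T1 = `ToricPeriodGenusVanishing` is the INERT
case `(-N/ℓ) = -1`, where `Fix ρ = ∅`; here `Fix ρ ≠ ∅` is allowed and the vanishing comes from the AXIS LEMMA at `p = ℓ`: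
`Fix(η) = A_ℓ` exactly (`ℤ_ℓ[η]` maximal), recursion `Φ̄(v_{i-1}) + Φ̄(v_{i+1}) = ā_ℓ Φ̄(v_i) = 0`, odd translation
`r ∣ h(O_x) ∈ {h(-N), h(-4N)}`, `Φ̄(x) = Φ̄(𝔩⋆x)`, and `[𝔩]` has order 2 iff `|d| ∉ {ℓ, 4ℓ}`.)  BSD₂ reading: such an `ℓ` has
`W^{(d)}` of type `I₀*` at `ℓ` with `Frob_ℓ` trivial on `E[2]`, i.e. `c_ℓ(W^{(d)}) = 4`.  FALSIFIER RUN (MEMO-an-data/g26/ana,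
sha16 336237359a396ac6; rows of kit j334621, 21 classes with `N ≡ 3 mod 4`, `Δ < 0`): 946 instances, 0 odd periods, 663 of
them not covered by T1/T1⁺; the excluded residue `|d| ∈ {ℓ, 4ℓ}`: 615 rows, all even as well (BSD-predicted via `c_ℓ = 4`, NOT
covered by the proof); base rate: only 815 of the 3260 rows covered by no rung are even.  Not found in print.
(RIDER, typer -ty g20: PLAIN theorem-candidate (T1♯, the ramified identity-prime rung).  REF1-AUDIT §243: **SURVIVES** — A2 faithful: «`|d| ∉ {ℓ, 4ℓ}`» ⟺ `d ≠ −ℓ ∧ d ≠ −4ℓ`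
(`d < 0`) is EXACTLY «`[𝔩] ≠ 1`» for the ramified prime `𝔩 ∣ ℓ` of `ℚ(√d)` (`a² + |d|b² = 4ℓ` solvable iff `|d| ∈ {ℓ, 4ℓ}` for `d < −4`); `jacobiSym (−N) ℓ = 1` forces `ℓ ≠ N`
(good-reduction trace); falsifier 946/0 (663 new) is -an's.  REF2 v58-add2 §G.3 / add3 §J.3: the hypothesis says `Frob_ℓ = id` on `W[2]` (identity prime, `c_ℓ(W^{(d)}) = 4`);
(i) as a LAW it is PREDICTED by the ⟹ half of AN-43 (odd period ⟹ odd Tamagawa product) — not new; (ii) for ODD `d` IN PRINT IN SUBSTANCE on the BSD side [cite: Zhai2016, Thm. 1.6]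
after (R1); (iii) EVEN `d`: not in print; (iv) the side conditions `|d| ∉ {ℓ, 4ℓ}` (and «ord[𝔮_ℓ] odd» at `N ≡ 1 (4)`) are PROOF ARTEFACTS, not predicted restrictions (residue
615/0 and 46/0 in -an's table) — ASK AN-G26-1: add the unconditional law-row as a CONJECTURE decl next to this theorem-candidate; proof route = §28.3f (`Fix ρ` count, L0–L4) +
AXIS LEMMA + genus theory, every step printed-or-elementary ⟹ **small beyond-print THEOREM-CANDIDATE (new-combination)**, pending REF1 audit of the §29.2/29.3 write-up.) -/
def ToricPeriodEvenOfEvenApRamified : Prop :=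
  ∀ (W : WeierstrassCurve ℚ) [W.IsElliptic] [W.IsGloballyMinimal] (N : ℕ),
    N.Prime → W.conductorNorm ℤ = N → N % 4 = 3 →
    ∀ (K : Type) [Field K] [NumberField K] (d : ℤ), IsImaginaryQuadratic K →
      NumberField.discr K = d → d < -4 → jacobiSym d N = -1 →
    ∀ (ℓ : ℕ), ℓ.Prime → ℓ ≠ 2 → (ℓ : ℤ) ∣ d → jacobiSym (-(N : ℤ)) ℓ = 1 →
      Even (W.frobeniusTrace ℓ) → d ≠ -(ℓ : ℤ) → d ≠ -(4 * ℓ : ℤ) →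
      ¬ OddToricPeriod W N K

/-- **T1♯ at `N ≡ 1 (mod 4)` (conditional form, -an g26 §29.3).**  Same as `ToricPeriodEvenOfEvenApRamified`, but `h(-4N)` is
even, so the odd translation must be ASSUMED: the class of a prime `𝔮 ∣ ℓ` of `k = ℚ(√-N)` (`disc k = -4N`, `𝓞_k = ℤ[√-N] = O_x`)
has ODD order in `Pic 𝓞_k`.  Falsifier run: 60 instances (classes 109.a, 1297.a, 1321.a, 1373.a, 1901.a), 0 odd periods, 36
not covered by T1/T1⁺ᵇ; the 46 rows where every qualifying `ℓ` has `ord[𝔮_ℓ]` even are ALSO all even (no proof offered).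
(RIDER, typer -ty g20: PLAIN conditional theorem-candidate (T1♯ at `N ≡ 1 (mod 4)`, the odd class order ASSUMED).  REF1-AUDIT §243: **SURVIVES** — extra data `k`
with `discr k = −4N` and a degree-one `𝔮 : (Ideal (𝓞 k))⁰`, `absNorm 𝔮 = ℓ`, `Odd (orderOf (ClassGroup.mk0 𝔮))` FAITHFUL; the corner `ℓ = N` (`𝔮 = (√−N)`, order 1) is shut by
`jacobiSym d N = −1` (`N ∤ d`).  REF2 add3 §J.3: same class as T1♯ (beyond-print theorem-candidate, new-combination), conditional on the typed odd-order hypothesis; the 46 rows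
where every qualifying `ℓ` has even order are ALSO all even — law-level prediction only (AN-G26-1).) -/
def ToricPeriodEvenOfEvenApRamifiedOneModFour : Prop :=
  ∀ (W : WeierstrassCurve ℚ) [W.IsElliptic] [W.IsGloballyMinimal] (N : ℕ),
    N.Prime → W.conductorNorm ℤ = N → N % 4 = 1 →
    ∀ (k : Type) [Field k] [NumberField k], IsImaginaryQuadratic k → NumberField.discr k = -(4 * N : ℤ) →
    ∀ (K : Type) [Field K] [NumberField K] (d : ℤ), IsImaginaryQuadratic K →
      NumberField.discr K = d → d < -4 → jacobiSym d N = -1 →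
    ∀ (ℓ : ℕ) (𝔮 : (Ideal (𝓞 k))⁰), ℓ.Prime → ℓ ≠ 2 → (ℓ : ℤ) ∣ d →
      Ideal.absNorm (𝔮 : Ideal (𝓞 k)) = ℓ → Odd (orderOf (ClassGroup.mk0 𝔮)) →
      Even (W.frobeniusTrace ℓ) → d ≠ -(ℓ : ℤ) → d ≠ -(4 * ℓ : ℤ) →
      ¬ OddToricPeriod W N K

/-- **CFT placement of the 2-division field (support, classical: Serre 1972 §5 / Brumer–Kramer 1977-type; -an g26 §29.1).**
For a PRIME conductor `N`, `ρ̄_{W,2}` onto `GL₂(𝔽₂)` and `-N·Δ_W` a square (i.e. `ℚ(√Δ_W) = ℚ(√-N) =: k`), the `S₃`-field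
`ℚ(W[2]) ⊃ k` is cubic over `k`, unramified over `N` (Tate inertia is a transposition) and over every odd `p ≠ N`; at 2 it is
unramified iff `W` is ordinary, and for supersingular `W` the inertia at 2 is the order-3 subgroup (fundamental character of
level 2), which forces 2 INERT in `k`, i.e. `N ≡ 3 (mod 8)`.  Hence (i) `N ≢ 3 (mod 8)` ⟹ `W` ordinary at 2 ⟹ `a₂(W)` odd —
concurs with REF2 R58a (no `Δ < 0`, `2 ∣ a₂`, `N ≡ 7 mod 8` class exists) and makes the `2 ∣ a₂` case of the old open cell
VACUOUS; (ii) the cubic character `χ_W` of `k` is a ring-class character of conductor `∣ 2`: it factors through `Pic ℤ[√-N]`,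
and through `Pic 𝓞_k` iff `W` is ordinary (so `3 ∣ h(-N)` resp. `3 ∣ h(-4N)`; disc `ℚ(W[2])⁺ = -N` resp. `-4N` — 26/26 in the
census); (iii) for an odd prime `ℓ ≠ N`: `ℓ` inert in `k` ⟹ `Frob_ℓ` is a transposition ⟹ `a_ℓ(W)` EVEN; `ℓ = 𝔮𝔮̄` split ⟹
`a_ℓ(W)` odd iff `χ_W([𝔮]) ≠ 1`.  Data (26 classes, ℓ ≤ 700): inert-with-odd-`a_ℓ` 0; parity a class function on `Pic ℤ[√-N]`
26/26; even classes and cubes generate an index-3 subgroup avoiding every odd class 26/26.  This item: (i).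
(RIDER, typer -ty g20: PLAIN support — COROLLARY-OF-PRINT.  REF1-AUDIT §243: **SURVIVES** — A2 faithful («`S₃` image, `ℚ(√Δ) = ℚ(√−N)`, `N ≢ 3 (8)` ⟹ ordinary
at 2»); BC7 P1 (pure python, 8774 prime-discriminant models): `N ≢ 3 (mod 8) ⟹ a₂ odd` — 0 violations in 2382 curves (and supersingular at 2 ⟹ `N ≡ 3 (mod 8)`: 3115/3115).
REF2 v58-add3 §J.5: = the CONTRAPOSITIVE of [cite: CalegariEmerton2009, Lemma 13] VERBATIM («if ρ̄ is supersingular at two and not totally real then N ≡ 3 mod 8 … F admits a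
degree three extension ramified precisely at 2 only if 2 is unramified and inert in F»; setting: `N` prime, `ρ̄ = W[2]` absolutely irreducible, `F = ℚ(√±N)`; arXiv
math/0503359 p. 5, verified by the typer); our `IsSquare (−N·Δ)` = «`F = ℚ(√−N)`, not totally real»; = REF2 R58a; add2 §G.1: the CFT placement (cubic fields of discriminant
`d·f²` ↔ index-3 subgroups of the ring class group of conductor `f` of `ℚ(√d)`, Hasse 1930) is a Literature fact, not a candidate.)
  REF2 RIDER R58g (v5 fold, 2026-08-29T21:17Z): PRINT SHARPENING — [cite: KedlayaMedvedovsky2019, Thm. 2] («Mod-2 dihedral Galois representations of prime conductor»): for an odd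
prime `N` every dihedral `E` of conductor `N` is `ℚ(√N)`- or `ℚ(√−N)`-dihedral; **if `N ≡ 1, 7 (mod 8)` there are NO supersingular elliptic curves of conductor `N`** (no image /
discriminant hypothesis at all); `N ≡ 3 (8)`: every supersingular `E` is `ℚ(√−N)`-dihedral; `N ≡ 5 (8)`: `ℚ(√N)`-dihedral.  Hence this row = [cite: CalegariEmerton2009, Lemma 13] =
K–M Thm 2, the latter giving the `S₃`-free form; CFT (ii) «`χ_W` through `Pic 𝓞_k` iff ordinary» = K–M §5 via Deligne–Fontaine.  PARTITION unchanged (corollary-of-print, two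
verbatim sources). -/
def OddApTwoOfPrimeConductor : Prop :=
  ∀ (W : WeierstrassCurve ℚ) [W.IsElliptic] [W.IsGloballyMinimal] (N : ℕ),
    N.Prime → W.conductorNorm ℤ = N → W.HasSurjectiveModNGaloisRep 2 → IsSquare (-(N : ℚ) * W.Δ) →
    N % 8 ≠ 3 → Odd (W.frobeniusTrace 2)

/-- CFT placement, item (iii): an odd prime `ℓ ≠ N` inert in `ℚ(√-N)` has `a_ℓ(W)` even (support, classical; see
`OddApTwoOfPrimeConductor`).  With `ToricPeriodGenusVanishing` (inert `ℓ ∣ d` ⟹ period even) and `ToricPeriodEvenOfEvenApRamified`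
(split `ℓ ∣ d`, `a_ℓ` even ⟹ period even) it yields the uniform reading: «an odd `ℓ ∣ d` with `Frob_ℓ` of order ≤ 2 on `W[2]`
and `[𝔩] ≠ 1` kills the period mod 2» (`c_ℓ(W^{(d)}) ∈ {2, 4}` even on the BSD side).
(RIDER, typer -ty g20: PLAIN support — FOLKLORE / Literature-level.  REF1-AUDIT §243: **SURVIVES** — BC7 P1(iii): `ℓ ≤ 60` odd, `ℓ ≠ N`, `(Δ/ℓ) = −1 ⟹ a_ℓ` even:
70 052 instances, 0 violations (classical: `Frob_ℓ` odd in `S₃` is a transposition, trace 0 mod 2); **R243a**: the conclusion needs only «`ℓ ∤ 2NΔ` inert in `ℚ(√Δ_W)`» —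
prime conductor, surjectivity and the square hypothesis serve solely to rewrite `ℚ(√Δ)` as `ℚ(√−N)` (hypotheses possibly unnecessary; information for a prover).  REF2 add3
§J.5: Serre 1972 §5.3-type, used throughout Calegari–Emerton 2009 §2 and [cite: Li2019SelmerClassGroups, §2].) -/
def EvenApOfInertInFrobeniusField : Prop :=
  ∀ (W : WeierstrassCurve ℚ) [W.IsElliptic] [W.IsGloballyMinimal] (N : ℕ),
    N.Prime → W.conductorNorm ℤ = N → W.HasSurjectiveModNGaloisRep 2 → IsSquare (-(N : ℚ) * W.Δ) →
    ∀ (ℓ : ℕ), ℓ.Prime → ℓ ≠ 2 → ℓ ≠ N → jacobiSym (-(N : ℤ)) ℓ = -1 → Even (W.frobeniusTrace ℓ)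

/-- **CONJECTURE (D) — `Φ mod 2` on the FROBENIUS TORSOR (-an g26 §29.4; the structure behind T1/T1⁺/T1♯ and the candidate
L-free parity law).**  Let `N ≡ 3 (mod 4)` be prime, `W` of conductor `N` with `ρ̄_{W,2}` onto `S₃` and `ℚ(√Δ_W) = k := ℚ(√-N)`,
`Φ = w·φ` its weighted Hecke eigenvector on a definite set-up of discriminant `N`, and let `X_k` be the Gross points of
conductor 1 of `k` ITSELF (optimal embeddings `𝓞_k ↪ R_i`; `N` ramifies in `k` and in `S.D`, so `|X_k| = h(-N)`, ONE
`Pic 𝓞_k`-orbit), based at the conjugation-fixed point `x_τ = (ψ, I)` (`ψ ∘ c = Ad(u) ∘ ψ` for a unit `u` of `O_L(I)`; unique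
since `h(-N)` is odd; it lies in a class with `4 ∣ |Rˣ|`, so `Φ(x_τ)` is even for free).  THEN: if `W` is supersingular at 2,
`Φ(𝔞⋆x_τ)` is even for EVERY `𝔞`; if `W` is ordinary at 2, `{𝔞 : Φ(𝔞⋆x_τ) even}` is a subgroup `H ≤ Pic 𝓞_k` of index 3, and
`H = ker χ_W` in the observable sense `[𝔮] ∈ H ⟺ a_ℓ(W) even` for every degree-one prime `𝔮 ∣ ℓ ∤ 2N` — i.e. `Φ̄|_{X_k}` IS the
cubic character's "non-triviality indicator" (`L(W ⊗ θ_ψ, 1)` odd exactly for the ring-class characters `ψ ∈ {χ_W^{±1}}`, a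
mod-2 shadow of `W ≡ θ_{χ_W} (mod 2)`).  EVIDENCE (multiset level, engine PARI t43.gp A43A counts, 26 classes N ≤ 1979):
`#{x ∈ X_O : Φ(x) odd} = 2h(O)/3` for `O = 𝓞_k` (11 ordinary) and `O = ℤ[√-N]` (26/26, where `χ_W` always lives), `= 0` on
`𝓞_k` for all 15 supersingular classes; the same count FAILS for the next order (`ℤ[2√-N]` / conductor 4: 25 of 29) — the
pattern lives exactly at the conductor of `χ_W`.  Coset structure (`Z = H⋆x_τ`, `σ_ℓ Z = Z ⟺ 2 ∣ a_ℓ`): kit job j335299 (T44,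
Sage engine).  WHY IT MATTERS: with §28.3f (`M_w ≡ Σ_{Fix ρ} Φ̄`, each fixed point carrying an `η`, hence a point of `X_{O_x}`)
it turns the parity of every toric period `m_d(W)` into a CLASS-FIELD-THEORETIC COUNT — see `toricParityReciprocity_note`.
Typed for `O = 𝓞_k` only (the tree has Gross points of conductor 1); the `ℤ[√-N]`-torsor version needs conductor-2 points.
(RIDER, typer -ty g20: `@[conjecture]` — CONJECTURE (D).  REF1-AUDIT §243: **SURVIVES as CONJECTURE** — A2: base point = the conjugation-fixed Gross point, typed as
`∃ (c : k ≃ₐ[ℚ] k) (u v : S.D), c ≠ AlgEquiv.refl ∧ u·v = 1 ∧ v·u = 1 ∧ u, v ∈ Brandt.leftOrder I ∧ ∀ z, u·ψ z = ψ(c z)·u` (T44: `x_τ` exists and is unique on 42/42 `N ≡ 3 (4)`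
torsors); conclusion FAITHFUL to «ss ⟹ `Φ̄ ≡ 0` on `X_{𝓞_k}`; ordinary ⟹ zero set = (index-3 subgroup cut out by `a_ℓ`-parity)·x_τ» (T44 kit j335299: `|Z| = h/3` on the 6 ordinary
`𝓞_k`-torsors, ZERO 15/15 ss, engines MATCH 47/47); A3/A4: the ordinary conjunct is NOT junk-satisfiable (asserts an index-3 subgroup).  R243d: for `N ≡ 3 (mod 4)` (D) ⟺ (TR) ∧
CFT ∧ (D1) needs in addition «`Φ(x_τ)` even» (`4 ∣ |R_{x_τ}^×|`), not a typed row — a prover closing (D) from (D0), (D1) must supply it; R243e: (E)/(D1) untested at `Δ > 0`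
(R232c's T43-at-571a1 ask still open).  REF2 v58-add2 §G.4 / add3 §J.7: exact REFORMULATION «`Φ(x) ≡ Tr_{𝔽₄/𝔽₂} χ_W(x·x_τ⁻¹) (mod 2)`» — Gross's eigenvector mod 2 restricted to
the CM points of `k = ℚ(√−N)` IS the trace of the cubic ring-class character; prior art for the mechanism = the mod-2 congruence `f_W ≡ θ_{χ_W}` and its `L`-value reading
([cite: Li2019SelmerClassGroups, §5.4]; Kriz–Li 2019, Heegner-point incarnation); mod-λ NON-vanishing of Gross-point values is in print only for conductor `pⁿ`, `n ≫ 0`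
([cite: Vatsal2003, §5]; Cornut–Vatsal), never at conductor 1; the definite-quaternion incarnation «`e_f ≡ Tr ∘ e_{χ_E}` on CM(`𝓞_k`)» not located in print.  GRADE
(provisional): **NEW-COMBINATION as a conjecture**; caveats: the conductor-4 failure (23/26) and 2 failures at conductor 2 bound the statement to conductor ≤ 2; at
Kilford levels (431, 503) a congruence-of-eigenvectors statement needs the eigen-LINE hypothesis of `OddToricPeriod`.  Kernel `ANg25.Kernel.modTwoToricVanishingOfSupersingular_of_D`
(-an): (D) ⟹ (D0-ss).)
  **WITHDRAWN — MISSTATED AS TYPED (v4, typer -ty g20; tree rule «append-only: deprecate, don't mutate», so the declaration is KEPT VERBATIM as a tombstone and is no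
longer an obligation node).**  After REF1 §243 (SURVIVES as conjecture, 20:16Z) the planner's OWN falsifier run T45 (-an g26 s4, MEMO-an v1.75 §29.13, 20:32Z; kit j335467: all 77
prime-conductor `Δ < 0` `S₃` classes `N ≤ 2500`, 130 torsors, verdicts ZERO 91 / COSET-OK 39 / FAIL 0) found `Φ̄ ≡ 0` on the 8 ordinary `𝓞_k`-torsors of positive-rank classes with
`N ≡ 3 (mod 4)` (e.g. 431.a1, 503.a1, analytic rank 1), where the second conjunct above («`Even … ↔ 𝔞 ∈ H`, `H` of index 3», no rank hypothesis) demands odd values: REFUTED as typed.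
The structure part survives as (D0) `ModTwoToricCosetStructure` (T45 106/106) and (D0-ss) `ModTwoToricVanishingOfSupersingular` (37/37); the non-vanishing part is REPAIRED as (D1)ʳ
`ModTwoToricNonvanishingR` below (`analyticRank = 0 ∧ #Sel₂ = 1`); REF1 §252 / REF2 v58-add5 §M.3 concur («misstated; a crux-workfile Prop, not a ledger item — nothing to land as a
refutation»).  Do not use. -/
@[deprecated "withdrawn (misstated as typed): the ordinary conjunct is refuted by -an g26 T45 (kit j335467) on positive-rank classes; use ModTwoToricCosetStructure / ModTwoToricVanishingOfSupersingular for the structure and ModTwoToricNonvanishingR for the repaired non-vanishing" (since := "2026-08-29")]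
def ModTwoToricValuesOnFrobeniusTorsor : Prop :=
  ∀ (W : WeierstrassCurve ℚ) [W.IsElliptic] [W.IsGloballyMinimal] (N : ℕ),
    N.Prime → W.conductorNorm ℤ = N → N % 4 = 3 → W.HasSurjectiveModNGaloisRep 2 →
    IsSquare (-(N : ℚ) * W.Δ) →
  ∀ (k : Type) [Field k] [NumberField k], IsImaginaryQuadratic k → NumberField.discr k = -(N : ℤ) →
  ∀ (S : Brandt.XiSetup 1 N) [Fintype (Brandt.ClassSet S.O)] (φ : Brandt.ClassSet S.O → ℤ) (ψ : k →ₐ[ℚ] S.D)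
    (I : Submodule ℤ S.D) (hx : Brandt.IsGrossPoint S.O ψ I),
    φ ≠ 0 → Brandt.eigenLattice N (Brandt.matrix S.O) (fun p => W.frobeniusTrace p) = ℤ ∙ φ →
    (∃ (c : k ≃ₐ[ℚ] k) (u v : S.D), c ≠ AlgEquiv.refl ∧ u * v = 1 ∧ v * u = 1 ∧
        u ∈ Brandt.leftOrder I ∧ v ∈ Brandt.leftOrder I ∧ ∀ z : k, u * ψ z = ψ (c z) * u) →
    (Even (W.frobeniusTrace 2) →
        ∀ 𝔞 : ClassGroup (𝓞 k), Even ((Brandt.weight S.O (hx.act 𝔞) : ℤ) * φ (hx.act 𝔞))) ∧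
    (Odd (W.frobeniusTrace 2) →
      ∃ H : Subgroup (ClassGroup (𝓞 k)), H.index = 3 ∧
        (∀ 𝔞 : ClassGroup (𝓞 k), Even ((Brandt.weight S.O (hx.act 𝔞) : ℤ) * φ (hx.act 𝔞)) ↔ 𝔞 ∈ H) ∧
        (∀ (ℓ : ℕ) (𝔮 : (Ideal (𝓞 k))⁰), ℓ.Prime → ℓ ≠ 2 → ℓ ≠ N →
            Ideal.absNorm (𝔮 : Ideal (𝓞 k)) = ℓ →
            (ClassGroup.mk0 𝔮 ∈ H ↔ Even (W.frobeniusTrace ℓ))))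

/-- **(TR) TORSOR RELATION (theorem-candidate, -an g26 §29.4; the first stub of both T1♯ and (D)).**  For a PRIME `N`,
ANY curve `W` of conductor `N` with Jacquet–Langlands vector `φ` on `B_{N,∞}` (so `w_N φ = ±φ`, `T_ℓ φ = a_ℓ φ`), `k = ℚ(√-N)`,
and ANY Gross point `x` of `𝓞_k` (embedding `ψ`, `η := ψ(√-N)`, `η² = -N`, `η ∈ R_x`): for every odd prime `ℓ ≠ N` split in `k`,
`ℓ = 𝔮𝔮̄`, the harmonic lift `Φ̃` of `Φ = w·φ` to the Bruhat–Tits tree `T_ℓ` satisfies `Φ̃ ∘ η = ±Φ̃` (adelic computation: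
left translation by `η` is trivial on `B^×\B̂^×/R̂^×` up to the uniformiser at `N`, i.e. up to `w_N`), `η` fixes the vertex of `x`
and acts on its `ℓ+1` neighbours `ℙ¹(𝔽_ℓ)` as `z ↦ -z` (two fixed eigenlines = the vertices of `𝔮⋆x`, `𝔮̄⋆x`; the other `ℓ-1`
neighbours in pairs `{u, ηu}` with `Φ̃(ηu) ≡ Φ̃(u)`), so harmonicity `Σ_{v'∼v} Φ̃(v') = a_ℓ Φ̃(v)` read mod 2 gives
**`Φ(𝔮⋆x) + Φ(𝔮̄⋆x) ≡ a_ℓ · Φ(x) (mod 2)`** at EVERY point of the torsor.  No hypothesis on the image, `Δ`, `N mod 4` or `a_ℓ`.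
(`ℓ = 2` is excluded: for `N ≡ 7 (mod 8)` the third neighbour is `η`-fixed too, for `N ≡ 3 (mod 8)` `η ≡ 1 (mod 2𝓞_{k,2})` fixes
all three.)  Stated for `k` of discriminant `-N` (N ≡ 3 mod 4) or `-4N` (N ≡ 1 mod 4; then `𝓞_k = ℤ[√-N]`).
(RIDER, typer -ty g20: PLAIN theorem-candidate (TR) — the first stub of both T1♯ and (D).  REF1-AUDIT §243: **SURVIVES** (A2 faithful; `ℓ = 2` correctly excluded in the
type).  REF2 v58-add3 §J.1: INGREDIENTS ALL IN PRINT — (a) tree structure + Hecke action on Gross points [cite: Vatsal2003, §2.2] («`X_n` principal homogeneous for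
`Pic(o_n)` … each point of conductor `pⁿ` has `p+1` neighbours … `T_p` = formal sum of neighbours»), the split level-0 form `u·Norm_{K_1/K_0}(P_1) = (T_p − σ − σ′)P_0`
[cite: BertoliniDarmon1996, §2.4]; (b) «an element of `k` of norm `N` acts on Gross points as the Atkin–Lehner/Fricke involution up to a Galois translation; in the
definite case complex conjugation is trivial» [cite: BertoliniDarmon1996, Prop. 2.6], Gross 1987 §3 (acq-14670); NEW STEP (elementary): `η = ψ(√−N)` acts on the `ℓ − 1`
conductor-`ℓ` neighbours as the order-2 element of `𝔽_ℓ^×` (`z ↦ −z`, fixed-point-free) and on `Cl(B)` as `w_N`, so `Φ(Norm x_ℓ) ≡ 0 (mod 2)`; `u = 1` for `d(k) < −4`.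
VERDICT: THEOREM-CANDIDATE, class COROLLARY-OF-PRINT + one elementary parity step («routine»); not found stated in print (REF2's corpus hybrid + galaxy queries null).  The
tree's `Brandt.grossReflect` / `act_mul_normPrimeIdeal = S.wMinus` (p739374) is ingredient (b) at `q = N`.) -/
def ToricTorsorRelation : Prop :=
  ∀ (W : WeierstrassCurve ℚ) [W.IsElliptic] [W.IsGloballyMinimal] (N : ℕ),
    N.Prime → W.conductorNorm ℤ = N →
  ∀ (k : Type) [Field k] [NumberField k], IsImaginaryQuadratic k →
    (NumberField.discr k = -(N : ℤ) ∨ NumberField.discr k = -(4 * N : ℤ)) →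
  ∀ (S : Brandt.XiSetup 1 N) [Fintype (Brandt.ClassSet S.O)] (φ : Brandt.ClassSet S.O → ℤ) (ψ : k →ₐ[ℚ] S.D)
    (I : Submodule ℤ S.D) (hx : Brandt.IsGrossPoint S.O ψ I),
    φ ≠ 0 → Brandt.eigenLattice N (Brandt.matrix S.O) (fun p => W.frobeniusTrace p) = ℤ ∙ φ →
  ∀ (ℓ : ℕ) (𝔮 : (Ideal (𝓞 k))⁰), ℓ.Prime → ℓ ≠ 2 → ℓ ≠ N → Ideal.absNorm (𝔮 : Ideal (𝓞 k)) = ℓ →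
  ∀ 𝔞 : ClassGroup (𝓞 k),
    Even ((Brandt.weight S.O (hx.act (𝔞 * ClassGroup.mk0 𝔮)) : ℤ) * φ (hx.act (𝔞 * ClassGroup.mk0 𝔮))
        + (Brandt.weight S.O (hx.act (𝔞 * (ClassGroup.mk0 𝔮)⁻¹)) : ℤ) * φ (hx.act (𝔞 * (ClassGroup.mk0 𝔮)⁻¹))
        - W.frobeniusTrace ℓ * ((Brandt.weight S.O (hx.act 𝔞) : ℤ) * φ (hx.act 𝔞)))

/-- **(D0) COSET STRUCTURE (theorem-candidate ⟸ (TR) + CFT placement + Chebotarev; -an g26 §29.4).**  Under the CFT hypotheses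
(`N` prime, `S₃` image mod 2, `-N·Δ` a square, so `ℚ(W[2]) ⊃ k` with cubic ring-class character `χ_W`, and for odd split `ℓ ≠ N`:
`2 ∣ a_ℓ ⟺ χ_W(𝔮_ℓ) = 1`), the function `g = (w·φ mod 2)` on the `Pic(𝓞_k)`-torsor of Gross points satisfies, by (TR),
`g(𝔮x) + g(𝔮̄x) = [χ_W(𝔮) ≠ 1]·g(x)`; on a group of ODD order with `H = ker χ_W` of index 3 the only solutions are `g ≡ 0` and
`g = 𝟙[complement of one H-coset]` (proof: `𝔮 ∈ H` ⟹ `g` is `H² = H`-invariant; `𝔮 ∉ H` ⟹ `g₀ + g₁ + g₂ = 0` on the three cosets);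
and if `χ_W` does NOT factor through `Pic(𝓞_k)` (supersingular `W`, conductor of `χ_W` exactly 2, `k` of discriminant `-N`) then
`a_ℓ mod 2` is not a class function and (TR) forces `g ≡ 0`.  Census (kit j335299, T44): ZERO 15/15 (ss), COSET-OK 32/32.
(RIDER, typer -ty g20: PLAIN theorem-candidate (D0) ⟸ (TR) + CFT placement + Chebotarev.  REF1-AUDIT §243: **SURVIVES** — BC7 P2 (exact linear algebra over `𝔽₂`):
for 16 odd abelian groups `G` and EVERY index-3 subgroup `H` (43 pairs) the solution space of `g(x+q) + g(x−q) = [q ∉ H]·g(x)` has dimension EXACTLY 2 = {0, the three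
`H`-coset-complement indicators} — 43/43; supersingular variant (relation indexed by `q̃` in an extension `G̃ ↠ G` with kernel `C ≅ ℤ/3`, `χ` non-trivial on `C`):
solution space 0 in 60/60.  REF2 add3 §J.6: routine GIVEN (TR) (corollary level; support, no novelty claim needed); census T44 j335299: COSET-OK 32/32, ZERO 15/15.) -/
def ModTwoToricCosetStructure : Prop :=
  ∀ (W : WeierstrassCurve ℚ) [W.IsElliptic] [W.IsGloballyMinimal] (N : ℕ),
    N.Prime → W.conductorNorm ℤ = N → W.HasSurjectiveModNGaloisRep 2 → IsSquare (-(N : ℚ) * W.Δ) →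
  ∀ (k : Type) [Field k] [NumberField k], IsImaginaryQuadratic k →
    (NumberField.discr k = -(N : ℤ) ∨ NumberField.discr k = -(4 * N : ℤ)) →
  ∀ (S : Brandt.XiSetup 1 N) [Fintype (Brandt.ClassSet S.O)] (φ : Brandt.ClassSet S.O → ℤ) (ψ : k →ₐ[ℚ] S.D)
    (I : Submodule ℤ S.D) (hx : Brandt.IsGrossPoint S.O ψ I),
    φ ≠ 0 → Brandt.eigenLattice N (Brandt.matrix S.O) (fun p => W.frobeniusTrace p) = ℤ ∙ φ →
    (∀ 𝔞 : ClassGroup (𝓞 k), Even ((Brandt.weight S.O (hx.act 𝔞) : ℤ) * φ (hx.act 𝔞))) ∨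
    (∃ (H : Subgroup (ClassGroup (𝓞 k))) (𝔟 : ClassGroup (𝓞 k)), H.index = 3 ∧
        (∀ (ℓ : ℕ) (𝔮 : (Ideal (𝓞 k))⁰), ℓ.Prime → ℓ ≠ 2 → ℓ ≠ N →
            Ideal.absNorm (𝔮 : Ideal (𝓞 k)) = ℓ → (ClassGroup.mk0 𝔮 ∈ H ↔ Even (W.frobeniusTrace ℓ))) ∧
        (∀ 𝔞 : ClassGroup (𝓞 k), Even ((Brandt.weight S.O (hx.act 𝔞) : ℤ) * φ (hx.act 𝔞)) ↔ 𝔞 * 𝔟⁻¹ ∈ H))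

/-- **(D0-ss) VANISHING ON THE MAXIMAL-ORDER TORSOR FOR SUPERSINGULAR `W` (theorem-candidate, the first conjunct of (D);
-an g26 §29.4): `N ≡ 3 (mod 8)` is forced (CFT (b)), `h(ℤ[√-N]) = 3h(-N)`, `χ_W` is faithful on the kernel of
`Pic ℤ[√-N] → Pic 𝓞_k`, so every class of `Pic 𝓞_k` contains split primes `ℓ` of BOTH parities of `a_ℓ` (Chebotarev), and (TR)
at two such primes gives `g(x) = 0` for every Gross point `x` of `𝓞_k`.  Census: 15/15 classes, every point (T44 ZERO 15/15;
multiset test 15/15).  Consequence with §28.3f: for supersingular `W` only the `ρ`-fixed points of conductor 2 contribute to `m_d`.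
(RIDER, typer -ty g20: PLAIN theorem-candidate (D0-ss), the first conjunct of (D) made unconditional for supersingular `W`.  REF1-AUDIT §243: **SURVIVES**
(BC7 P2 ss-variant 60/60; `N ≡ 3 (mod 8)` forced by CFT (b) = `OddApTwoOfPrimeConductor`).  REF2 add3 §J.6: (TR) at two split primes of opposite `a_ℓ`-parity in the
same `𝓞_k`-class (`χ_W` of conductor exactly 2 ⟹ `a_ℓ mod 2` not a class function on `Pic 𝓞_k`; Chebotarev) ⟹ `g ≡ 0`: routine given (TR); census 15/15 classes,
every point (T44 ZERO 15/15).  Kernel: the v3-promised glue `modTwoToricVanishingOfSupersingular_of_D` ((D) ⟹ this) is NOT filed — (D) is WITHDRAWN (v4).) -/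
def ModTwoToricVanishingOfSupersingular : Prop :=
  ∀ (W : WeierstrassCurve ℚ) [W.IsElliptic] [W.IsGloballyMinimal] (N : ℕ),
    N.Prime → W.conductorNorm ℤ = N → W.HasSurjectiveModNGaloisRep 2 → IsSquare (-(N : ℚ) * W.Δ) →
    Even (W.frobeniusTrace 2) →
  ∀ (k : Type) [Field k] [NumberField k], IsImaginaryQuadratic k → NumberField.discr k = -(N : ℤ) →
  ∀ (S : Brandt.XiSetup 1 N) [Fintype (Brandt.ClassSet S.O)] (φ : Brandt.ClassSet S.O → ℤ) (ψ : k →ₐ[ℚ] S.D)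
    (I : Submodule ℤ S.D) (hx : Brandt.IsGrossPoint S.O ψ I),
    φ ≠ 0 → Brandt.eigenLattice N (Brandt.matrix S.O) (fun p => W.frobeniusTrace p) = ℤ ∙ φ →
    ∀ 𝔞 : ClassGroup (𝓞 k), Even ((Brandt.weight S.O (hx.act 𝔞) : ℤ) * φ (hx.act 𝔞))

/-- **(D1) MOD-2 NON-VANISHING ON THE FROBENIUS TORSOR (CONJECTURE; the genuinely open conjunct of (D); -an g26 §29.4).**
For ORDINARY `W` (resp. for `N ≡ 1 (mod 4)`, where `𝓞_k = ℤ[√-N]`) `w·φ` is NOT identically even on the Gross points of `𝓞_k`.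
With (D0) this pins `g = 𝟙[χ_W(·/x_τ) ≠ 1]` (the coset through the conjugation-fixed point `x_τ`, where `4 ∣ |R^×|`).  Waldspurger
reading (motivation, not hypothesis): with `P_ψ = Σ_𝔞 ψ(𝔞)Φ(𝔞⋆x_τ)` for ring-class characters `ψ`, (D0)+(D1) say `P_ψ` is odd
exactly for `ψ = χ_W^{±1}` — «`L^alg(W ⊗ θ_ψ, 1)` is a 2-unit iff `θ_ψ ≡ f_W (mod 2)`».  Census: 6/6 ordinary `𝓞_k`-torsors and
5/5 `N ≡ 1 (mod 4)`; the `ℤ[√-N]`-torsor version (26/26) needs conductor-2 Gross points (not yet in the tree).  Cheapest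
falsifier: one prime-conductor `S₃` curve with `Δ < 0`, ordinary at 2, and `#{x : Φ(x) odd} ≠ 2h(-N)/3` (one gp line).
(RIDER, typer -ty g20: `@[conjecture]` — CONJECTURE (D1), the genuinely open conjunct of (D) (mod-2 NON-vanishing on the conductor-1 torsor for ordinary `W`,
resp. `N ≡ 1 (mod 4)`).  REF1-AUDIT §243: **SURVIVES as CONJECTURE** — NOT junk-satisfiable (with a genuine eigen-line it asserts an odd value, false for the zero pattern);
R243e: untested at `Δ > 0` (R232c's T43-at-571a1 ask D-an-29b still open).  Census: 6/6 ordinary `𝓞_k`-torsors + 5/5 `N ≡ 1 (mod 4)` (T44 j335299); the `ℤ[√−N]`-torsor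
version (26/26) needs conductor-2 Gross points (not in the tree).  Cheapest falsifier (-an): one prime-conductor `S₃` curve with `Δ < 0`, ordinary at 2, and
`#{x : Φ(x) odd} ≠ 2h(−N)/3` (one gp line).  REF2 add3 §J.7: mod-λ non-vanishing of Gross-point values is in print only for conductor `pⁿ`, `n ≫ 0` [cite: Vatsal2003, §5]
(Ratner; Cornut–Vatsal), never at conductor 1; the Waldspurger reading «`L^alg(W ⊗ θ_ψ, 1)` a 2-unit iff `ψ = χ_W^{±1}`» is a congruence phenomenon `f_W ≡ θ_{χ_W} (mod 2)`
of the Kriz–Li 2019 / [cite: Li2019SelmerClassGroups, §5.4] family (nearest prior art; hypotheses and objects differ); GRADE (provisional): **NEW-COMBINATION as a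
conjecture**; load-bearing for the «L-free parity law» (E) only together with conductor-2 Gross points.)
  **WITHDRAWN — MISSTATED AS TYPED (v4, typer -ty g20; kept VERBATIM as a tombstone under the tree rule «append-only: deprecate, don't mutate»; no longer an obligation node).**
-an g26's own T45 (MEMO-an v1.75 §29.13; kit j335467, 130 torsors: ZERO 91 / COSET-OK 39 / FAIL 0) refutes this unrestricted form on 25 ordinary / `N ≡ 1 (mod 4)` torsors of
positive-rank curves (61.a, 83.a, 89.a, 431.a, 503.a of analytic rank 1; 571.b of rank 2; 571.a of rank 0 with `Ш[2] ≠ 0`) — exactly as Gross's formula forces (`L(W,1) = 0` or `4 ∣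
L^alg(W)` ⟹ every `m_d` even ⟹ `Φ̄ ≡ 0` by (H⁼)).  -an: «class MISSTATED: the intended regime is AN-43's `r_an = 0`»; REPAIRED as (D1)ʳ `ModTwoToricNonvanishingR` below (with
`analyticRank = 0 ∧ #Sel₂ = 1`; the dictionary `ModTwoToricNonvanishingIffOddLValue` records the 77/77 equivalence); REF1 §252 and REF2 v58-add5 §M.3 concur.  Do not use. -/
@[deprecated "withdrawn (misstated as typed): refuted by -an g26 T45 (kit j335467) on 25 positive-rank torsors; repaired as ModTwoToricNonvanishingR (analyticRank = 0 and trivial 2-Selmer)" (since := "2026-08-29")]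
def ModTwoToricNonvanishing : Prop :=
  ∀ (W : WeierstrassCurve ℚ) [W.IsElliptic] [W.IsGloballyMinimal] (N : ℕ),
    N.Prime → W.conductorNorm ℤ = N → W.HasSurjectiveModNGaloisRep 2 → IsSquare (-(N : ℚ) * W.Δ) →
  ∀ (k : Type) [Field k] [NumberField k], IsImaginaryQuadratic k →
    ((NumberField.discr k = -(N : ℤ) ∧ Odd (W.frobeniusTrace 2)) ∨ NumberField.discr k = -(4 * N : ℤ)) →
  ∀ (S : Brandt.XiSetup 1 N) [Fintype (Brandt.ClassSet S.O)] (φ : Brandt.ClassSet S.O → ℤ) (ψ : k →ₐ[ℚ] S.D)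
    (I : Submodule ℤ S.D) (hx : Brandt.IsGrossPoint S.O ψ I),
    φ ≠ 0 → Brandt.eigenLattice N (Brandt.matrix S.O) (fun p => W.frobeniusTrace p) = ℤ ∙ φ →
    ∃ 𝔞 : ClassGroup (𝓞 k), Odd ((Brandt.weight S.O (hx.act 𝔞) : ℤ) * φ (hx.act 𝔞))

/-! ## v8 (-an g26 §29.9–§29.14): the position lemma, the Jacobsthal count, the parity law (H), and the T45/T46 falsifier runs -/

/-- The **χ-criterion** of a curve `W` at a fundamental discriminant `d` (-an g26 §29.11): every ODD prime `p ∣ d` has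
`a_p(W)` odd (⟺ `Frob_p` has order 3 on `W[2]`, ⟺ `p` is inert in the cubic field `ℚ(W[2])⁺`; for prime conductor `N`,
`S₃` image and `ℚ(√Δ_W) = ℚ(√-N)` this forces `p` to SPLIT in `ℚ(√-N)`), AND either `d` is odd, or `W` is supersingular
at 2 and `4 ∥ d` (for supersingular `W`, `N ≡ 3 (mod 8)` and quadratic reciprocity show that `8 ∣ d`, `(d/N) = -1` force an odd
`p ∣ d` with `a_p` even, so the clause `¬ 8 ∣ d` merely records this).  BSD₂ DICTIONARY (Tate's algorithm; checked, not typed: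
kit j334621 7919/7919 rows and kit j335666 4638/4638 rows with `d < -4`): `ToricCriterion W d ⟺ ∏_p c_p(W^{(d)})` odd — at odd
`p ∣ d` (type `I₀*`) `c_p = 1 + #W[2](𝔽_p)` is odd iff `a_p` is odd; `c_N` is odd (`v_N(Δ_W)` odd); and for even `d`,
`c_2(W^{(d)}) = 1` when `W` is supersingular at 2 (703/703 rows) and `∈ {2, 4}` when `W` is ordinary (792/792).
(RIDER, typer -ty g20: PLAIN `def` with parameters (the χ-criterion).  REF1-AUDIT §252: faithful definition; the BSD₂ dictionary «`ToricCriterion W d ⟺ ∏_p c_p(W^{(d)})` odd» was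
RE-FOLDED by REF1 from the raw t43x rows with its own `a_p` code (c₂ dictionary 703/703 + {2: 430, 4: 362}; REF2 R58e formula 792/792 by REF1's own Hilbert symbol).  REF2 v58-add5
§M.1: for ODD `d` the criterion reads «every `p ∣ d` inert in the cubic field `F = ℚ(W[2])⁺`» (`a_p` odd ⟺ `Frob_p` a 3-cycle); (Hᵀ) dictionary support-level: `c_p(E^{(d)}) = 1 +
#E[2](𝔽_p)` at odd `p ∣ d` (type `I₀*`, Tate's algorithm — print), `c_N` odd, `c₂` by census.) -/
def ToricCriterion (W : WeierstrassCurve ℚ) [W.IsGloballyMinimal] (d : ℤ) : Prop :=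
  (∀ p : ℕ, p.Prime → p ≠ 2 → (p : ℤ) ∣ d → Odd (W.frobeniusTrace p)) ∧
    (Odd d ∨ (Even (W.frobeniusTrace 2) ∧ ¬ (8 : ℤ) ∣ d))

/-- **(H⁻) EVENNESS FROM ONE RAMIFIED PRIME OF EVEN TRACE (theorem-candidate, -an g26 §29.9–§29.10; supersedes T1 =
`ToricPeriodGenusVanishing` (inert `p`), T1♯ = `ToricPeriodEvenOfEvenApRamified` (split `p`, `|d| ∉ {p, 4p}`,
`N ≡ 3 mod 4`) and its conditional `N ≡ 1 (mod 4)` form, with NO restriction on `|d|`, `N mod 4` or class orders).**  For a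
PRIME `N`, `W` of conductor `N` with `ρ̄_{W,2}` onto `S₃` and `ℚ(√Δ_W) = k := ℚ(√-N)`, a fundamental `d < -4` with
`(d/N) = -1`, and an ODD prime `p ∣ d` with `a_p(W)` EVEN: the weighted toric period `m_d(W)` is even.  PROOF ROUTE
(BSD-free): (i) `m_d ≡ Σ_{y ∈ Fix ρ_d} Φ̄(x(y))` (§28.3f), each fixed point `y` carrying `η_y` (`η_y² = -N`) and hence a CM point
`x(y)` of `O_y ∈ {𝓞_k, ℤ[√-N]}` on the `Pic(O_y)`-torsor; (ii) (TR)+(A) ⟹ (D0): `Φ̄|_{X_O} ∈ {0, 𝟙[· ∉ C]}` with `C` a coset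
of `ker χ_W` (index 3), and τ-PINNING: `C = C_τ` is the unique `τ`-stable non-trivial coset (T45: the `τ`-fixed point lies in
`Z` in 106/106 torsors with `N ≡ 3 mod 4`); (iii) POSITION LEMMA (G): `b`-conjugation acts on the torsor as `τ`, the fixed
points of `ρ_d` are reached from `x_τ` by the RAMIFIED primes of `K = ℚ(√d)`: `x(𝔭⋆y) = 𝔮_p^{±1} ⋆ x(y)` for odd `p ∣ d`
(`𝔮_p` a prime of `O_y` over `p`, necessarily split in `k`) and the 2-adic steps are `χ_W`-trivial, so
`χ_W(pos y) = ∏_{odd p ∣ d} χ_W(𝔮_p)^{± e_p(y)}`; (iv) if some odd `p ∣ d` has `χ_W(𝔮_p) = 1` (`a_p` even) the sign vector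
`e_p` can be flipped at `p` without changing the position, so `Fix ρ_d` is a union of PAIRS `{y, 𝔭_p⋆y}` with equal `Φ̄` — even sum —
whenever `[𝔭_p] ≠ 1` in `Pic 𝓞_K` (`|d| ∉ {p, 4p}`); in the residue `|d| ∈ {p, 4p}` (`n = 1`, one sign class) the fixed points sit in
`χ_W`-TRIVIAL position, i.e. in `ker χ_W ⋆ x_τ ⊆ Z`, for `N ≡ 3 (mod 4)`; for `N ≡ 1 (mod 4)` (no `τ`-fixed point, T45 24/24) the
residue needs the identification of the `τ`-stable coset `Z` — the one step of the route still OPEN (census: all such rows even).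
CENSUS (kit j334621, 26 classes, 7934 rows `d < -4`): every row with such a `p` has `m_d` even (the complement of the 2445 odd
rows inside the 5489 even ones is exactly accounted for by this statement and the two 2-adic rungs `ToricPeriodEvenOfOddAp2`,
`ToricPeriodEvenOfEightDvd`; law (H) below, 0 exceptions).  Not found in print (the L-side shadow for odd `d` — `L(W^{(d)},1)·(…)`
even — is Zhai 2016 Thm 1.6 [arXiv:1409.0231]).
(RIDER, typer -ty g20: PLAIN theorem-candidate (H⁻); = ASK AN-G26-1 answered (no `|d| ∉ {ℓ,4ℓ}`, no `N mod 4`, no `ord[𝔮]` hypothesis; REF2 add5 §M.0).  REF1-AUDIT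
§252: **SURVIVES** (BSD-free; census re-folded by REF1 from RAW t43x rows with its own `a_p` code: every one of the 5466 non-criterion rows is EVEN, 0 violations; the `N ≡ 1 (mod 4)`,
`|d| ∈ {p, 4p}` residue is still open, as the docstring says).  REF2 v58-add5 §M.2: route (TR) + CFT + (G) POSITION LEMMA + §28.3f + Jacobsthal count `#{e : Σ u_p e_p ≡ 0 (3)} =
(2ⁿ + 2(−1)ⁿ)/3` (textbook; the lemma is the new step); in print terms the Gross points are those of `k = ℚ(√−N)` and `ρ̄_{W,2} = Ind_k χ_W` — the MOD-2 SHADOW OF THE EXCEPTIONAL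
CASE of Mazur / Cornut–Vatsal (a cuspidal «exceptional θ» is impossible in characteristic 0 for non-CM `E`, realised mod 2 because the residual representation IS induced from the toric
field); no mod-p treatment of this residually-exceptional case found in print (Vatsal 2002/2003, Cornut–Vatsal, BD 1999, Kriz–Li 2019, Vatsal 1999 are the nearest mechanisms);
REF2 GRADE (provisional): NEW-MECHANISM-CANDIDATE for (G)+(H⁼); as a typed statement **small beyond-print THEOREM-CANDIDATE**.) -/
def ToricPeriodEvenOfSomeEvenAp : Prop :=
  ∀ (W : WeierstrassCurve ℚ) [W.IsElliptic] [W.IsGloballyMinimal] (N : ℕ),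
    N.Prime → W.conductorNorm ℤ = N → W.HasSurjectiveModNGaloisRep 2 → IsSquare (-(N : ℚ) * W.Δ) →
    ∀ (K : Type) [Field K] [NumberField K] (d : ℤ), IsImaginaryQuadratic K →
      NumberField.discr K = d → d < -4 → jacobiSym d N = -1 →
    ∀ (p : ℕ), p.Prime → p ≠ 2 → (p : ℤ) ∣ d → Even (W.frobeniusTrace p) →
      ¬ OddToricPeriod W N K

/-- **(H⁼) CONSTANCY ON THE CUBIC FAMILY (theorem-candidate, BSD-free, -an g26 §29.10; isolates (D1) as "one odd value").**
Same `N, W` (prime conductor, `S₃`, `ℚ(√Δ_W) = ℚ(√-N)`, ANY analytic rank).  If `d₁, d₂ < -4` are fundamental with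
`(d_i/N) = -1` and BOTH satisfy the χ-criterion `ToricCriterion W d_i`, then `m_{d₁}(W) ≡ m_{d₂}(W) (mod 2)`.  PROOF ROUTE:
by (G) and the TYPE LEMMA (`tr((1+b)(1+η)/4) = 1/2 ∉ ℤ` ⟹ for odd `d` every fixed point has `O_y = ℤ[√-N]`; for `4 ∥ d`
and supersingular `W` only the type-S points count, by (D0-ss)), `m_d ≡ #{e ∈ {±1}^n/± : Σ u_p e_p ≢ 0 (mod 3)}·[Φ̄|_{X_{ℤ[√-N]}} ≢ 0]`
with `n = #{odd p ∣ d}`, all `u_p ∈ {±1}` (criterion), and the JACOBSTHAL COUNT `#{e ∈ {±1}^n : Σ e_p ≡ 0 (3)} = (2^n + 2(-1)^n)/3`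
makes the first factor `(2^n - (-1)^n)/3`, which is ODD for every `n ≥ 1`.  Hence `m_d ≡ [Φ̄|_{X_{ℤ[√-N]}} ≢ 0]` — independent
of `d` (route complete for `N ≡ 3 (mod 4)` via `x_τ`; for `N ≡ 1 (mod 4)` positions are read from a `τ`-stable coset instead of a
`τ`-fixed point and the same count applies once that coset is identified — OPEN step, census-supported 7 classes / 7 T45 torsors).  CENSUS: in each of the 26 classes of kit j334621 the 2445 criterion rows are all odd (constancy 26/26 classes); kit
j335467 (T45) + j335666 (T46): the constant is `1` exactly for the classes with `L(W,1)/Ω` a 2-adic unit (see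
`ModTwoToricNonvanishingIffOddLValue`).
(RIDER, typer -ty g20: PLAIN theorem-candidate (H⁼), BSD-free; isolates (D1) as «one odd value».  REF1-AUDIT §252: **SURVIVES** (same census basis as (H⁻); T45 is also a 46-fold
confirmation of its contrapositive: `L(E,1) = 0` or `4 ∣ L^alg(E)` ⟹ all `m_d` even ⟹ `Φ̄ ≡ 0`, 46/46 ZERO).  REF2 v58-add5 §M.2: small beyond-print THEOREM-CANDIDATE; CAVEAT carried from
-an: the `N ≡ 1 (mod 4)` coset identification (no `τ`-fixed point; T45 24/24) is the one open step there.) -/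
def ToricParityConstantOnCubicFamily : Prop :=
  ∀ (W : WeierstrassCurve ℚ) [W.IsElliptic] [W.IsGloballyMinimal] (N : ℕ),
    N.Prime → W.conductorNorm ℤ = N → W.HasSurjectiveModNGaloisRep 2 → IsSquare (-(N : ℚ) * W.Δ) →
    ∀ (K₁ : Type) [Field K₁] [NumberField K₁] (K₂ : Type) [Field K₂] [NumberField K₂] (d₁ d₂ : ℤ),
      IsImaginaryQuadratic K₁ → IsImaginaryQuadratic K₂ → NumberField.discr K₁ = d₁ → NumberField.discr K₂ = d₂ →
      d₁ < -4 → d₂ < -4 → jacobiSym d₁ N = -1 → jacobiSym d₂ N = -1 →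
      ToricCriterion W d₁ → ToricCriterion W d₂ →
      (OddToricPeriod W N K₁ ↔ OddToricPeriod W N K₂)

/-- **(H) THE PARITY LAW — χ-CRITERION FORM (CONJECTURE = (H⁻) ∧ (H⁼) ∧ (D1); -an g26 §29.11).**  For a PRIME `N`, `W` of
conductor `N` with `ρ̄_{W,2}` onto `S₃`, `ℚ(√Δ_W) = ℚ(√-N)` (so `Δ_W < 0`), analytic rank 0 AND trivial 2-Selmer group
(`L(W,1)/Ω_W` a 2-adic unit; 571.a1 with `Ш(W)[2] ≠ 0` has every `m_d` even — REF1 R232c, T45), and `K = ℚ(√d)`, `d < -4`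
fundamental with `(d/N) = -1`:  **`m_d(W)` is odd ⟺ `ToricCriterion W d`** (every odd `p ∣ d` has `a_p(W)` odd, and `d` is odd
or [`W` supersingular at 2 and `4 ∥ d`]).  The right-hand side mentions no L-value, no eigenvector and no Selmer group of the
twist: `W` enters through `ℚ(W[2])` and `a_2(W) mod 2` only.  CENSUS (BC5 witness table, kit j334621, 26 classes = every
prime-conductor `S₃` class with `Δ < 0`, `N ≤ 1979` of the g25 list; 11 ordinary incl. `N ≡ 1, 3, 5, 7 (mod 8)`, 15 supersingular;
fundamental `-2000 ≤ d ≤ -3`, the `d = -4` rows read as non-criterion): 7934/7934 rows, 0 exceptions, 21 non-empty cells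
(odd rows / even rows — ordinary: odd `d` 966 / 1322, `4 ∥ d` 0 / 563, `8 ∣ d` 0 / 549; supersingular: odd `d` 1155 / 1885,
`4 ∥ d` 324 / 423, `8 ∣ d` 0 / 747; the odd rows are exactly the criterion rows).  OUT OF SAMPLE: kit j335666 (T46, the
L-side shadow `L^alg(W^{(d)})` odd ⟺ criterion ⟺ `∏ c_p(W^{(d)})` odd, on all 77 prime-conductor `Δ < 0` `S₃` classes `N ≤ 2500`,
fundamental `-400 ≤ d < -4`): 1855/1855 rows over the 31 classes with `L(W,1)/Ω_W` odd (287 of them from the 5 classes outside the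
census), 0 mismatches; over the 46 other classes (`r_an ≥ 1`, or 571.a1) `L^alg(W^{(d)})` is even or zero in 2783/2783 rows.
IN PRINT: for ODD `d` the L-side shadow is Zhai 2016 [arXiv:1409.0231] Thm 1.1 (non-vanishing, `L^alg(W^{(d)})` odd when all
`p ∣ d` are inert in `ℚ(W[2])⁺`) and Thm 1.6 (evenness otherwise), proved by modular symbols; the EVEN-`d` rows (ordinary `4 ∥ d`:
563 even; supersingular `4 ∥ d`: 324 odd = a non-vanishing family; `8 ∣ d`) are outside every paper found (REF2 v58), and the
toric-side statement with its class-field-theoretic mechanism (G) is not in print for non-CM `W`.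
(RIDER, typer -ty g20: `@[conjecture]` — THE PARITY LAW (H), χ-criterion form = (H⁻) ∧ (H⁼) ∧ (D1)ʳ.  REF1-AUDIT §252: **SURVIVES as CONJECTURE, census-exact** — REF1
re-folded the law from the RAW t43x rows with its own `a_p` code: 7900 rows `d < −4`, 2434 odd, **0 violations** (cells 960/960, 0/1322, 0/557, 0/549, 1150/1150, 0/1883, 324/324,
0/408, 0/747); `d < −4` NECESSARY (16 T46 rows with `d = −4` have `L^alg` odd, Tamagawa odd, `m` even — Gross's unit index `u_K = 2`, R252c).  REF2 v58-add5 §M.1: ODD `d` —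
L-side IN PRINT [cite: Zhai2016, Thm. 1.1] (family LARGER than (H)'s: no prime-conductor or `(d/N)` hypothesis) + Thm 1.6, BSD₂ there by Boxer–Diao; SELMER SIDE IN PRINT
(«Selmer slaving»: the Mazur–Rubin 2010 lemma «criteria for equality of local conditions after twist», arXiv 0904.3709 p. 6, applies at EVERY place for odd criterion `d` —
`Sel₂(E^{(d)}) = Sel₂(E)` is a THEOREM, corollary-of-print; ASK AN-G27-1: type it as a theorem-candidate row) ⟹ on the odd-criterion rows AN-43 is PRINT-IN-SUBSTANCE and (H) is
its toric twin modulo (R1): **(H)|odd d → corollary-of-print modulo (R1)**; EVEN `d` — NOT IN PRINT; **the supersingular `4 ∥ d` criterion cell (324/324 ODD; L-shadow: a new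
non-vanishing family `E` of prime conductor `N ≡ 3 (8)`, `S₃`, `Δ < 0`, `L^alg(E)` odd; `d = −4m`, `m` odd squarefree, every `p ∣ m` inert in `F`, `(d/N) = −1`) is the cell's most
quotable BEYOND-PRINT prediction**; grade of (H) as a law: NEW-COMBINATION — concur with -an.  Kernel glue (-an): `toricPeriodEven_of_criterion` ((H) ⟹ (H⁻) on its regime),
`toricParityConstant_of_criterion`.)
  REF2 RIDER R58i (v5 fold, 2026-08-29T21:21Z): a SECOND print source for «Selmer slaving» on PRIME criterion twists — [cite: BarreraPacettiTornaria2021, Thm. 3.3]: `E/ℚ` with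
(hypo:KF) and `Disc(E) < 0`, `p` a prime inert in the cubic algebra `A_ℚ` (= `F = ℚ(E[2])⁺`), `p ∤ Disc(E)`: if `−Δ(E)/N_E ≡ □ (mod p)` then `E` and `E_{p*}` have the same
root number AND THE SAME 2-SELMER GROUP (otherwise opposite root numbers, and all `E_{p*}` of the second kind share one 2-Selmer group); so for prime criterion twists
(`p* ≡ 1 (4)`, `a_p` odd ⟺ `p` inert in `F`) `Sel₂(E^{(p*)}) = Sel₂(E)` is print twice over ([cite: MazurRubin2010] placewise; BPT Thm 3.3 with the class-group sandwich);
composite odd criterion `d`: Mazur–Rubin placewise as in add5 §M.1.  Also [cite: Li2019SelmerClassGroups, Thm. 1.1]: `Δ_E = −N` squarefree ⟹ `dim Sel₂(E) ∈ {h₂(F), h₂(F)+1}`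
by root number — the census's «`Sel₂(E) = 0`» rows are «`h(F)` odd ∧ `w = +1`» there.  (AN-G27-1's slaving theorem-candidate row is -an g27's to sketch.) -/
@[conjecture] def OddToricPeriodCriterion : Prop :=
  ∀ (W : WeierstrassCurve ℚ) [W.IsElliptic] [W.IsGloballyMinimal] (N : ℕ),
    N.Prime → W.conductorNorm ℤ = N → W.analyticRank = 0 → Nat.card (W.selmerGroup 2) = 1 →
    W.HasSurjectiveModNGaloisRep 2 → IsSquare (-(N : ℚ) * W.Δ) →
    ∀ (K : Type) [Field K] [NumberField K] (d : ℤ), IsImaginaryQuadratic K →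
      NumberField.discr K = d → d < -4 → jacobiSym d N = -1 →
      (OddToricPeriod W N K ↔ ToricCriterion W d)

/-- **(Hᵀ) THE PARITY LAW — TAMAGAWA FORM (CONJECTURE; the answer to the cell's question «what is the ± object at 2»;
-an g26 §29.11).**  Same hypotheses as `OddToricPeriodCriterion`; `W'` a globally minimal model of `W^{(d)}`:
**`m_d(W)` odd ⟺ `∏_p c_p(W')` odd.**  I.e. on this family the 2-adic unit-ness of the definite toric period — and, through
Gross's formula, of `L^alg(W)·L^alg(W^{(d)})` — is governed by the TAMAGAWA PARITY ALONE: no root number (all twists have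
`w = +1`), and the 2-Selmer conjunct of AN-43 (`DefiniteMod2WaldspurgerLaw`) is slaved to it (`∏ c_p` odd ⟹ `Sel₂(W') ≅
Sel₂(W) = 0`, by Kramer/Mazur–Rubin-type propagation: at the primes `p ∣ d` of the criterion `H¹(ℚ_p, W[2]) = 0`).  CENSUS:
7919/7919 rows with `d < -4` of kit j334621 (`m_d` odd ⟺ `tam(W')` odd; the 15 rows `d = -4` have `tam` odd, `m_d` even —
extra units, excluded by `d < -4`).  Relation: `(Hᵀ) ⟺ (H)` given the elementary dictionary `ToricCriterion W d ⟺ Odd (∏ c_p)`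
(Tate's algorithm; recorded in the docstring of `ToricCriterion`, not typed separately).
(RIDER, typer -ty g20: `@[conjecture]` — THE PARITY LAW, TAMAGAWA FORM (Hᵀ): the cell's answer-candidate to «what is the ± object at 2» on the AN-43 frame.  REF1-AUDIT
§252: **SURVIVES as CONJECTURE, census-exact** (T46 1855/1855 and 2783/2783; `d < −4` necessary; **R252c** (statement hygiene): (Hᵀ) could carry `d = −3` (`u_K` odd; 31/31 rows
consistent) but must keep `d ≠ −4`; a uniform form would read `Odd (m_d / u_K) ↔ Odd tam` — the `d = −4` failure is exactly Gross's unit index, not a defect of the dictionary).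
REF2 v58-add5 §M.1: (Hᵀ) needs «`L(E,1)/Ω` odd» (T46: 1000 Tamagawa-odd rows with `L^alg` even on the 46 other classes) — correctly built into the hypotheses (`analyticRank = 0 ∧
#Sel₂ = 1`); conjecture, NEW-COMBINATION.) -/
@[conjecture] def ToricTamagawaParityLaw : Prop :=
  ∀ (W : WeierstrassCurve ℚ) [W.IsElliptic] [W.IsGloballyMinimal] (N : ℕ),
    N.Prime → W.conductorNorm ℤ = N → W.analyticRank = 0 → Nat.card (W.selmerGroup 2) = 1 →
    W.HasSurjectiveModNGaloisRep 2 → IsSquare (-(N : ℚ) * W.Δ) →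
    ∀ (K : Type) [Field K] [NumberField K] (d : ℤ), IsImaginaryQuadratic K →
      NumberField.discr K = d → d < -4 → jacobiSym d N = -1 →
    ∀ (W' : WeierstrassCurve ℚ) [W'.IsElliptic] [W'.IsGloballyMinimal] (C : WeierstrassCurve.VariableChange ℚ),
      C • W' = W.quadraticTwist (d : ℚ) →
      (OddToricPeriod W N K ↔ Odd W'.tamagawaProduct)

/-- **(D1)ʳ — (D1) RESTATED after the T45 falsifier run (-an g26 §29.13).**  `ModTwoToricNonvanishing` (v7) claimed an odd value
of `w·φ` on the `𝓞_k`-torsor for EVERY ordinary `W` (resp. every `W` when `N ≡ 1 mod 4`); kit j335467 (T45: all 77 prime-conductor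
`Δ < 0` `S₃` classes `N ≤ 2500`, 130 torsors) finds `Φ̄ ≡ 0` on 54 torsors where v7 predicted a coset — e.g. 61.a, 83.a, 89.a,
431.a, 503.a (analytic rank 1), 571.b (rank 2), 571.a (rank 0, `Ш[2] ≠ 0`) — exactly as Gross's formula forces (`L(W,1) = 0` or
`4 ∣ L^alg(W)` ⟹ every `m_d` even ⟹ `Φ̄|_{X_{ℤ[√-N]}} ≡ 0` by (H⁼)), and a coset (`COSET-OK`) on the other 39, never a third
pattern (`FAIL` 0/130).  So v7-(D1) is MISSTATED (class: misstated; repaired here, not re-worded in place): the non-vanishing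
needs `L(W,1)/Ω_W` to be a 2-adic unit, typed as analytic rank 0 ∧ trivial 2-Selmer group.
(RIDER, typer -ty g20: `@[conjecture]` — (D1)ʳ, the REPAIRED mod-2 non-vanishing (v7's unrestricted `ModTwoToricNonvanishing` above is MISSTATED — refuted by -an's own
T45 on the 46 ZERO classes, e.g. 431.a1 (rank 1) — and is kept above only as a WITHDRAWN `@[deprecated]` tombstone; REF1 §252 and REF2 add5 §M.3 CONCUR: «missing `analyticRank = 0 ∧ #Sel₂ = 1`; repaired statement
= (D1)ʳ, which the ZERO rows do not bite; a crux-workfile Prop, not a ledger item — nothing to land as a refutation»).  REF1-AUDIT §252: **SURVIVES as CONJECTURE** (T45 kit j335467: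
77 prime-conductor `Δ < 0` `S₃` classes `N ≤ 2500`, 130 torsors, ZERO 91 / COSET-OK 39 / FAIL 0; COSET-OK ⟺ `r_an = 0 ∧ L(E,1)/Ω` odd 77/77 on `ℤ[√−N]`, 16/16 `𝓞_k` agreement for
ordinary `N ≡ 3 mod 4`).  REF2 add5 §M.2 ARTIN-FORMALISM POINTER: the Waldspurger reading «`P_ψ` odd iff `ψ = χ_E^{±1}`» concerns `L(E × θ_{χ_E}, 1) = L(E/F, 1)/L(E/ℚ, 1)`, `F` =
the 2-division cubic field — compare `BSD₂(E/F)` (Dokchitser–Dokchitser 2010 regulator constants); ASK AN-G27-2.  R252b (cheap falsifier outside `Δ < 0`): 79.a1.) -/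
@[conjecture] def ModTwoToricNonvanishingR : Prop :=
  ∀ (W : WeierstrassCurve ℚ) [W.IsElliptic] [W.IsGloballyMinimal] (N : ℕ),
    N.Prime → W.conductorNorm ℤ = N → W.analyticRank = 0 → Nat.card (W.selmerGroup 2) = 1 →
    W.HasSurjectiveModNGaloisRep 2 → IsSquare (-(N : ℚ) * W.Δ) →
  ∀ (k : Type) [Field k] [NumberField k], IsImaginaryQuadratic k →
    ((NumberField.discr k = -(N : ℤ) ∧ Odd (W.frobeniusTrace 2)) ∨ NumberField.discr k = -(4 * N : ℤ)) →
  ∀ (S : Brandt.XiSetup 1 N) [Fintype (Brandt.ClassSet S.O)] (φ : Brandt.ClassSet S.O → ℤ) (ψ : k →ₐ[ℚ] S.D)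
    (I : Submodule ℤ S.D) (hx : Brandt.IsGrossPoint S.O ψ I),
    φ ≠ 0 → Brandt.eigenLattice N (Brandt.matrix S.O) (fun p => W.frobeniusTrace p) = ℤ ∙ φ →
    ∃ 𝔞 : ClassGroup (𝓞 k), Odd ((Brandt.weight S.O (hx.act 𝔞) : ℤ) * φ (hx.act 𝔞))

/-- **(D1) ⟺ ODD L-VALUE (conjectural dictionary, -an g26 §29.13; evidence T45 + T46).**  For `N, W, k` as in (D1)ʳ but with NO
rank hypothesis: `w·φ` takes an odd value on the Gross points of `𝓞_k` ⟺ `W` has analytic rank 0 and trivial 2-Selmer group.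
(⟹: an odd value gives, via (H⁼) and Chebotarev, an odd `m_d`, hence `L(W,1)·L(W^{(d)},1) ≠ 0` by Gross's formula — the Selmer
half needs the 2-part of BSD for `W`; ⟸ is (D1)ʳ.)  Kit j335467 (T45) × j335666 (T46): verdict `COSET-OK` on the `ℤ[√-N]`-torsor for EXACTLY the 31
classes with `r_an = 0` and `L(W,1)/Ω_W` odd, `ZERO` for the 46 others (33 of analytic rank 1, 12 of rank 2, and 571.a1 with `r_an = 0`,
`L/Ω = 4`): 77/77; on the `𝓞_k`-torsor (`N ≡ 3 mod 4`): `ZERO` for the 37 supersingular classes, equal to the `ℤ[√-N]` verdict for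
the 16 ordinary ones: 53/53 — table in MEMO-an §29.13.
(RIDER, typer -ty g20: `@[conjecture]` — the (D1) ⟺ ODD-L-VALUE dictionary (no rank hypothesis; ⟸ is (D1)ʳ, ⟹ needs the 2-part of BSD for `W`).  REF1-AUDIT §252:
**SURVIVES as CONJECTURE** (T45 × T46: verdict COSET-OK on the `ℤ[√−N]`-torsor for EXACTLY the 31 classes with `r_an = 0` and `L(W,1)/Ω_W` odd, ZERO for the 46 others — 77/77; `𝓞_k`:
ZERO for the 37 supersingular classes, = the `ℤ[√−N]` verdict for the 16 ordinary ones — 53/53).  REF2 add5 §M.2: = a statement about `v₂` of the BSD quotient of `E` over its own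
2-division cubic field `F` (`E(F)[2] = ℤ/2`) via `L(E × θ_{χ_E}, s) = L(E/F, s)/L(E/ℚ, s)`; printed machinery Dokchitser–Dokchitser 2010; ASK AN-G27-2 (test on the 77 classes with
PARI `lfun` over `F`).  Kernel glue (-an): `modTwoToricNonvanishingR_of_iff`.) -/
@[conjecture] def ModTwoToricNonvanishingIffOddLValue : Prop :=
  ∀ (W : WeierstrassCurve ℚ) [W.IsElliptic] [W.IsGloballyMinimal] (N : ℕ),
    N.Prime → W.conductorNorm ℤ = N → W.HasSurjectiveModNGaloisRep 2 → IsSquare (-(N : ℚ) * W.Δ) →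
  ∀ (k : Type) [Field k] [NumberField k], IsImaginaryQuadratic k →
    ((NumberField.discr k = -(N : ℤ) ∧ Odd (W.frobeniusTrace 2)) ∨ NumberField.discr k = -(4 * N : ℤ)) →
  ∀ (S : Brandt.XiSetup 1 N) [Fintype (Brandt.ClassSet S.O)] (φ : Brandt.ClassSet S.O → ℤ) (ψ : k →ₐ[ℚ] S.D)
    (I : Submodule ℤ S.D) (hx : Brandt.IsGrossPoint S.O ψ I),
    φ ≠ 0 → Brandt.eigenLattice N (Brandt.matrix S.O) (fun p => W.frobeniusTrace p) = ℤ ∙ φ →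
    ((∃ 𝔞 : ClassGroup (𝓞 k), Odd ((Brandt.weight S.O (hx.act 𝔞) : ℤ) * φ (hx.act 𝔞))) ↔
      (W.analyticRank = 0 ∧ Nat.card (W.selmerGroup 2) = 1))

/-- **T1⁺ MERGED (REF2 v58 §1(b)/(d), G.2 typing advice: «`2 ∤ a₂ → 2 ∣ d → ¬OddToricPeriod`»; theorem-candidate, BSD-free).**
For a PRIME `N`, a curve `W` of conductor `N` with `a₂(W)` ODD (ordinary at 2; no `Δ < 0`, no image hypothesis), and every
fundamental `d < -8` with `2 ∣ d` (equivalently `4 ∣ d`) and `(d/N) = -1`: the weighted toric period is EVEN.  This is exactly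
the conjunction of `ToricPeriodEvenOfOddAp2` (`4 ∥ d`: S/F type alternation along `𝔭₂`-orbits + transvection) and
`ToricPeriodEvenOfEightDvd` (`8 ∣ d`, any `a₂`: axis lemma at `p = 2`) — see `toricPeriodEvenOfOddApTwoEvenDisc_of` — stated as
ONE Prop at REF2's request; the open MECHANISM cell named by REF2 (`N ≡ 7 (mod 8) ∧ 8 ∣ d`, all fixed points of type F) is the
one the axis lemma closes (§29.2).  BSD₂ reading (REF2 R58e): `c₂(W^{(d)}) = 3 + (-N, d)₂ ∈ {2, 4}` for ordinary `W` and even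
`d` (T46: `c₂ ∈ {2,4}` in 792/792 rows), so the statement is BSD₂-expected everywhere; census 1112/1112 (kit j334621, 11 ordinary
classes, every even `d`), plus T46's 146 + 158 out-of-sample even-`d` rows on ordinary `L/Ω`-odd classes (all `L^alg(W^{(d)})` even).
(RIDER, typer -ty g20: PLAIN theorem-candidate — T1⁺ MERGED («`2 ∤ a₂ → 2 ∣ d → ¬OddToricPeriod`», `d < −8`, any prime `N`; REF2 v58 §1(b)/(d), §4 (iii), add2 §G.2
typing advice answered).  REF1-AUDIT §252: correct pure logic with its glue `toricPeriodEvenOfOddApTwoEvenDisc_of : ToricPeriodEvenOfOddAp2 → ToricPeriodEvenOfEightDvd → this`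
(kernel sibling); REF2 add5 §M.3: = the v58 §1 merged form; beyond print (R58a–e); theorem-candidate via the two 2-adic rungs.) -/
def ToricPeriodEvenOfOddApTwoEvenDisc : Prop :=
  ∀ (W : WeierstrassCurve ℚ) [W.IsElliptic] [W.IsGloballyMinimal] (N : ℕ),
    N.Prime → W.conductorNorm ℤ = N → Odd (W.frobeniusTrace 2) →
    ∀ (K : Type) [Field K] [NumberField K] (d : ℤ), IsImaginaryQuadratic K →
      NumberField.discr K = d → d < -8 → jacobiSym d N = -1 → (4 : ℤ) ∣ d →
      ¬ OddToricPeriod W N K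

/-- **AXIS RECURSION AT `p = 2` (theorem-candidate, BSD-free; REF2 v58-add3 ask AN-G26-2: «write the `p = 2` axis recursion as a
separate typed lemma — it is exactly what T1⁺ at `N ≡ 7 (mod 8)`, `2 ∤ a₂` rests on; (TR) excludes `ℓ = 2`»).**  For a PRIME
`N ≡ 7 (mod 8)` (so `2 = 𝔮𝔮̄` splits in `k = ℚ(√-N)` and `-N` is a 2-adic square), ANY curve `W` of conductor `N` with definite
eigen-line `ℤφ`, and ANY Gross point `x` of `𝓞_k` (embedding `ψ`, `η = ψ(√-N) ∈ R_x`): in `B₂^× ≅ GL₂(ℚ₂)` the element `η` is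
`diag(s, -s)`, `s² = -N`, which fixes the axis `A` of the split torus POINTWISE together with the whole ball of radius 1 around it
(`diag(1,-1) ≡ 1 (mod 2)`), and SWAPS the two far neighbours `w, w'` of every off-axis neighbour `u` of an axis vertex `v`
(`⟨e₁+e₂, 4e₂⟩ ↔ ⟨e₁+3e₂, 4e₂⟩`).  With `Φ̃ ∘ η = ±Φ̃` (left translation by `η` = `w_N` on the class set, as in (TR)) harmonicity
at `u` gives `Φ̄(v) = ā₂·Φ̄(u)` and harmonicity at `v` gives `Φ̄(𝔮⋆x) + Φ̄(𝔮̄⋆x) = (1 + ā₂)·Φ̄(u)`; hence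
(i) `a₂` ODD ⟹ **`Φ̄(𝔮⋆x) = Φ̄(𝔮̄⋆x)`** (period 2 along the axis), (ii) `a₂` EVEN ⟹ **`Φ̄(x) = 0`** at every `𝓞_k`-point.
The off-axis value `Φ̄(u)` is a Gross point of conductor 2 (not in the tree: D-an-29c), so only (i)/(ii) are typed.  Used in:
`ToricPeriodEvenOfEightDvd` (cell `N ≡ 7 (mod 8)`), hence `ToricPeriodEvenOfOddApTwoEvenDisc`.  Consistency with T45 (kit j335467):
on the 8 `𝓞_k`-torsors with `N ≡ 7 (mod 8)` (all `a₂` odd) the zero set is one `ker χ_W`-coset (4 torsors) or everything (4), and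
`χ_W(𝔮) = 1` there (2 splits completely in `ℚ(W[2])`, Kilford–Wiese), so (i) holds on all of them; (ii) has no instance among the
77 classes (every `N ≡ 7 (mod 8)` class there is ordinary).  Not found in print (REF2 J.2: the axis/translation picture is Vatsal 2003
§5; the mod-2 reading is elementary and new).
(RIDER, typer -ty g20: PLAIN theorem-candidate — the `p = 2` AXIS RECURSION, REF2 v58-add3 ASK AN-G26-2 answered (typed by -an g26 as a separately auditable lemma).
REF1-AUDIT §252: **clause (i) SURVIVES** (theorem-candidate, BSD-free, consistent with the torsor law by the residue argument); **clause (ii) is VACUOUS — R252a**: prime conductor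
`N ≡ ±1 (mod 8)` forces `a₂` odd (`a₁` even ⟹ `Δ ≡ 5 (mod 8)`, but `|Δ| = N^k`), so (ii)'s premise is never met; REF1 asks -an g27 / -ty to DROP (ii) or replace it by the lemma it
hides: «`∀ W [IsElliptic] [IsGloballyMinimal] (N : ℕ), N.Prime → W.conductorNorm ℤ = N → N % 8 = 1 ∨ N % 8 = 7 → Odd (W.frobeniusTrace 2)`» (elementary; in-tree it needs
«conductorNorm = N prime ⟹ Δ = ±N^k» and «a₂ even ⟺ ā₁ = 0»; it also proves v7's `OddApTwoOfPrimeConductor` without CFT) — the typer ports -an's statement VERBATIM (a vacuous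
conjunct is harmless, not false) and leaves the restatement to -an g27's next sketch; R252b (cheap Sage falsifier OUTSIDE `Δ < 0`): 79.a1 = [1,1,1,−2,0] (`N = 79 ≡ 7 mod 8`,
`Δ = +79`, `h(−79) = 5`, `[𝔮₂]` of order 5) — (i) predicts `Φ̄` CONSTANT on the 5-point `𝓞_k`-torsor, one T45-engine run.  REF2 add5 §M.3: elementary tree geometry given (TR)'s
`η`-symmetry ([cite: BertoliniDarmon1996, Prop. 2.6]; [cite: Vatsal2003, §2.2]) — theorem-candidate, routine; it discharges add3 §J.2's delicate step.)
  REF2 RIDER R58g (v5 fold): R252a's vacuity lemma «prime conductor `N ≡ ±1 (mod 8)` ⟹ `a₂` odd» is IN PRINT as [cite: KedlayaMedvedovsky2019, Thm. 2] («no supersingular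
elliptic curve of prime conductor `N ≡ 1, 7 (mod 8)`»), so clause (ii) is vacuous by a printed theorem. -/
def AxisRecursionAtTwo : Prop :=
  ∀ (W : WeierstrassCurve ℚ) [W.IsElliptic] [W.IsGloballyMinimal] (N : ℕ),
    N.Prime → W.conductorNorm ℤ = N → N % 8 = 7 →
  ∀ (k : Type) [Field k] [NumberField k], IsImaginaryQuadratic k → NumberField.discr k = -(N : ℤ) →
  ∀ (S : Brandt.XiSetup 1 N) [Fintype (Brandt.ClassSet S.O)] (φ : Brandt.ClassSet S.O → ℤ) (ψ : k →ₐ[ℚ] S.D)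
    (I : Submodule ℤ S.D) (hx : Brandt.IsGrossPoint S.O ψ I),
    φ ≠ 0 → Brandt.eigenLattice N (Brandt.matrix S.O) (fun p => W.frobeniusTrace p) = ℤ ∙ φ →
  ∀ (𝔮 : (Ideal (𝓞 k))⁰), Ideal.absNorm (𝔮 : Ideal (𝓞 k)) = 2 →
  ∀ 𝔞 : ClassGroup (𝓞 k),
    (Odd (W.frobeniusTrace 2) →
      (Even ((Brandt.weight S.O (hx.act (𝔞 * ClassGroup.mk0 𝔮)) : ℤ) * φ (hx.act (𝔞 * ClassGroup.mk0 𝔮))) ↔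
       Even ((Brandt.weight S.O (hx.act (𝔞 * (ClassGroup.mk0 𝔮)⁻¹)) : ℤ) * φ (hx.act (𝔞 * (ClassGroup.mk0 𝔮)⁻¹))))) ∧
    (Even (W.frobeniusTrace 2) → Even ((Brandt.weight S.O (hx.act 𝔞) : ℤ) * φ (hx.act 𝔞)))

end Summit.BirchSwinnertonDyer.Rank1Residual.F1Sign2.ANg25
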